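import Literature.MathematicalPhysics.QuantumFieldTheory.BalabanImbrieJaffe1984to88.BIJ85NeumannPropagatorRegularDecay
import Literature.MathematicalPhysics.QuantumFieldTheory.Balaban1983to89.B1Ineq226RegularRegionSum
import Literature.MathematicalPhysics.QuantumFieldTheory.Balaban1983to89.B3Bound323ZeroTorus

/-!
# `BalabanImbrieJaffe1984to88.BIJ85NeumannPropagatorRegularDeriv` — T. Bałaban, J. Imbrie, A. Jaffe, *Renormalization of the Higgs model:
# minimizers, propagators and the stability of mean field theory*, Commun. Math. Phys. **97** (1985) 299–329 [BalabanImbrieJaffe1985], §7.3 p. 326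
# [PDF 28] «The propagators arising from Δ_k(u_k) … also satisfy the regularity and decay estimates of [7]», [7] = T. Bałaban, *Regularity and decay
# of lattice Green's functions*, Commun. Math. Phys. **89** (1983) 571–597 [Balaban1983RegularityDecay] Theorem p. 573 (1.10)–(1.12), [B1] = T. Bałaban,
# *(Higgs)₂,₃ quantum fields in a finite volume. I*, Commun. Math. Phys. **85** (1982) 603–626 [Balaban1982Higgs1] Prop. 2.1 (2.25)–(2.26) pp. 610–611:
# **THE COVARIANT-DERIVATIVE MEMBERS `|(D^η_{A,μ}G_k(Ω,A)f)(x)|` OF (1.10)/(2.25) AND OF THE `δG` CLAUSE (1.11)–(1.12)/(2.26) FOR THE REGION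
# NEUMANN PROPAGATORS `G_k(Ω,u)` OF [BalabanImbrieJaffe1988] (2.27)/(5.6.10) (p31's `gBox (α_kL^{kd}) ε⁻¹ u k Ω`) AT `u = e^{ieεA}` WITH `A`
# (2.23)-REGULAR — PROVED from p35's [B1] Prop. 2.1 derivative members for regions (`B1Ineq225DerivRegularRegion.norm_covDeriv_propagatorK_region_reg_decay_sum`,
# `B1Ineq226RegularRegionSum.deltaG_region_reg_decay_sum`) BY NAME through the dictionary for the covariant derivative (`covDeriv_rfield`: [B1]'s
# `D^ε_{A_H}φ_ℝ` IS r18's `covD ε⁻¹ u φ`), the `ε`-scaling at fixed charge (`covDeriv_scaleBy_div`) and the massive problems `m² = t² ↓ 0` of the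
# companion files `BIJ85NeumannPropagatorRegularDecay` / `BIJ85NeumannPropagatorRegularClose` (value members, same seat).**

statement-level skeleton of published theorems with citation tags; proofs where landed; nothing here is a claim about the Yang–Mills mass gap

PDFs held: `paper:balaban1985-cmp97-bij-higgs-minimizers` (p. 326 [PDF 28]); `paper:balaban1982-cmp85-higgs23-i` (pp. 605, 610–611 [PDF 3, 8–9]);
`paper:balaban1983-cmp89-regularity-decay` (p. 573 [PDF 3]) — re-read on the materialised pages 2026-08-23.

CITATION HEADER (lean-in-tree rule).  Cell `lit-balaban` (HOME `run/shared/lean/pub/lit-balaban/`), Phase 2, reader seat **r01 gen 26** (unit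
`lit-balaban-r01`, literature-prover-lit-balaban-r01-g26-0; B4 fold owner), free-target protocol G.5-34(d), file 2 of the TAKING of HOME/STATUS.md
2026-08-23T00:42:06Z (file 1 = `BIJ85NeumannPropagatorRegularClose`, p346673).  Rows served (cells only, no head change): **B4.Thm@573** (owner r01:
the C2-carrier instance of [7]'s Theorem p. 573 at `A ≠ 0`, DERIVATIVE members of (1.10) and of (1.11)–(1.12), REGIONS), **C1.Eq7.3.1-7.3.2** (owner
r15: `C1-CLOSURE.md` §5 item 3 residual «the D_u-derivative … members at non-flat u» — here at a REGULAR `u = e^{ieεA}`, regions), **C2.Eq2.30 /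
C2.Eq2.31** (owner r18: the derivative input shapes of gen 17 §4 at a regular non-flat `u`, print's row-restricted form).  USED BY NAME, never
restated: p35's two region theorems above, typer's `HiggsLattice.covDeriv` ((1.7) p.605) / `HiggsCovariance.propagatorK` / `HiggsRescaling`,
r18's `BIJ88Sect3Statements.covD`/`cfg`, p31's `BIJ88NeumannPropagator227Torus` (`nOp`, `gBox`, `proj`, `isUnit_nPad`, `nOp_mul_gBox`,
`gBox_mul_proj`), p38's `B5Ineq137Torus.T` with `B3Bound323ZeroTorus.T_eq_supDist`, this seat's dictionary (`rotCharge`, `higgsOf`, `eSite`,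
`eSite_shift`, `expGauge`, `vecH`, `rfield`, `regH`, `U_bond_toE`, `propagatorK_rfield_eq`, …), `BIJ85NeumannPropagatorRegularDecay`
(`U_scaleBy_div`, `propagatorK_scaleBy_div`, `isBlockUnion_of_bigBlocks`, `isBigBlockUnion_regH`, `supDist_eSite`, `chi_smul_eq`,
`support_of_massive_eq`, `isUnit_nOp_add_mass`); the companion `BIJ85NeumannPropagatorRegularClose` (p346673; same `hB2` hypothesis shape) is
not imported (nothing of it is used): imports = `BIJ85NeumannPropagatorRegularDecay` + p35 `B1Ineq226RegularRegionSum` + p26/p03 `B3Bound323ZeroTorus`.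

WHAT IS PRINTED (verbatim).  [7] p. 573 [PDF 3]: *«Similarly |(D^η_{A,μ}G_k(Ω, A)f)(x)|, |(G_k(Ω, A)(x)| ≦ c₀exp(−δ₀dist(x, supp f))‖f‖_∞ (1.10)
for x ∈ Ω, dist(x, Ω^c) ≧ R₀. If Ω ⊂ Ω₀, then for δG_k(Ω, Ω₀, A) … (1.11) we have the inequalities … (with the same restrictions on x, x′) with the
additional factor (1.12) on the right hand sides.»*  [B1] p. 605 [PDF 3]: the covariant derivative `(D^η_Aφ)(b) = η⁻¹(U(A_b)φ(b₊) − φ(b₋))` (1.7);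
pp. 610–611: (2.25) «|(D^η_{A,μ}G_k(Ω,A)f)(x)|, |(G_k(Ω,A)f)(x)| ≦ c₀exp(−δ₀dist(x,supp f))‖f‖_∞ … for x ∈ Ω, dist(x,Ω^c) ≧ R₀», (2.26) «we have
the inequalities (2.24), (2.25) with the additional factor exp(−δ₀ dist(supp f, Ω^c) − δ₀ dist({x, x′}, Ω^c)) on the right sides … Ω^c means a
complement in T_η».  [BIJ88] p. 263: *«Bounds analogous to (2.30), (2.31) hold for covariant derivatives … of G_{k,loc}(u) of order less than two.»*

WHAT THIS FILE PROVES (kernel-checked, 0 `sorry`; theorems only — no definition, no `Prop` fact).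
* §1 THE DICTIONARY FOR THE COVARIANT DERIVATIVE: **`covDeriv_rfield`** — `D^ε_{A_H}φ_ℝ(⟨x,μ⟩) = (covD ε⁻¹ u φ ⟨x,μ⟩)_ℝ`, `u = e^{ieεA}` ([B1] (1.7)
  = r18's (3.3): the same bond, the link variable acting as `u_b`); **`covDeriv_scaleBy_div`** — under `ε ↦ tε`, `A ↦ t⁻¹A` at fixed charge,
  `D^{tε}_{t⁻¹A} = t⁻¹D^{ε}_A` (the transports are scale-free, `U_scaleBy_div`; the difference quotient scales by the spacing).
* §2 the massive problems: **`norm_covD_massive_solution_le`** ((2.25) derivative member for the `Ω`-supported solution of `(nOp_Ω + t²)ψ = h`,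
  uniform in `t ∈ (0,1]`: `‖(D_uψ)(⟨x,μ⟩)‖ ≦ c₀(L^kε)e^{−D/(4L^sL^k)}M`) and **`norm_covD_massive_diff_le`** ((2.26) derivative member:
  `‖(D_u(ψ − ψ₀))(⟨x,μ⟩)‖ ≦ c₀(L^kε)e^{−(D+D₀+D₁)/(8L^sL^k)}M`) — p35's inner statements as the hypotheses `hB1d`, `hB2`, on the `tε`-torus:
  `(D_uψ)_ℝ = D^ε_{A_H}G^ε_k(Ω_H,A_H;t²)h_ℝ = t⁻²·D^ε_{A_H}G^{tε}_k(Ω_H,t⁻¹A_H;1)h_ℝ = t⁻¹·D^{tε}_{t⁻¹A_H}G^{tε}_k(…;1)h_ℝ`, and p35's `c₀(tL^kε)`.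
* §3 **`norm_covD_gBox_mulVec_le`** — [7] (1.10) = [B1] (2.25), DERIVATIVE MEMBER, REGION PROPAGATORS AT `u = e^{ieεA}`: `∃ s₀, ∀ s ≧ s₀, ∃ c₀ e₁ >
  0`: on every `Setup` torus, `1 ≦ k ≦ K`, `k + s ≦ m + K`, `3L^kL^s ≦ 2L^{m+K}`, `Ω` a union of big blocks (`L^k·L^s` sites), `A` (2.23)-regular on `Ω`
  (`0 < e_k ≦ e₁`), `x` with `{|y − x| ≦ 2rS + 2L^kL^s(d+1) + 1} ⊂ Ω`, `f` with `|f| ≦ M` vanishing on `{|z − x| < D}`, every direction `μ`: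
  `‖ε⁻¹(u_{⟨x,μ⟩}(G_k(Ω,u)f)(x+e_μ) − (G_k(Ω,u)f)(x))‖ ≦ c₀(L^kε)·exp(−D/(4L^s·L^k))·M` (r18's `covD P.eps⁻¹ (cfg u)`); resolvent identity
  `G_k(Ω,u)f = ψ_{t²}(1_Ωf) + t²ψ_{t²}(G_k(Ω,u)f)`, §2 for both terms, `t ↓ 0`.  **`norm_covD_gBox_univ_mulVec_le`** — `Ω = T^{(0)}` (no `R₀`).
* §4 **`norm_covD_gBox_sub_gBox_mulVec_le`** — [7] (1.11)–(1.12) = [B1] (2.26), DERIVATIVE MEMBER: for `Ω ⊆ Ω₀` big-block unions, `A` regular on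
  `Ω₀`, `x` as above, `f` supported in `Ω`, `D₀ ≦ dist(x,T∖Ω)`, `D₁ ≦ dist(supp f,T∖Ω)`:
  `‖(D_u(G_k(Ω,u)f − G_k(Ω₀,u)f))(⟨x,μ⟩)‖ ≦ c₀(L^kε)·exp(−(D+D₀+D₁)/(8L^s·L^k))·M`.  **`norm_covD_gBox_sub_gBox_univ_mulVec_le`** — `Ω₀ = T^{(0)}`.
* §5 THE DERIVATIVE INPUT SHAPES of gen 17 §4 (`decay110_flat_cube_deriv_level`, `close112_flat_cube_deriv_level`) AT A REGULAR `u = e^{ieεA}`, in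
  p31's level-`k` units and p38's metric: **`input110_deriv_regular_univ`** (X = T^{(0)}, every bond), **`input110_deriv_regular_deep`**,
  **`input112_deriv_regular_deep`** (print's row-restricted form: the bond's source `x` with the `(R₀′+1)`-ball inside `□`, distances to `T∖□`).
HONEST SCOPE.  (i) Derivative members in the print's `D^η_{A,μ}` (forward bond at `x`) form only; no Hölder member (1.9)/(2.24).  (ii) `u` is
EXACTLY `e^{ieεA}` with `A` regular (on `Ω`, resp. `Ω₀`); no gauge change performed.  (iii) Constants: p35's (`M = K₀ = L^s`; rates `1/(4L^s)`,
`1/(8L^s)` per `L^kε`); prefactor ONE power of `L^kε` (as printed in (2.25) for the derivative: the carrier's `c₀(L^Kε)`).  (iv) `N = 2`; `R₀` in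
the site form with radius `2rS + 2L^kL^s(d+1) + 1` (p35's derivative theorems; one more than the value member of the companion file), so the
bond `⟨x, x+e_μ⟩` lies inside `Ω`; distances to `T∖Ω`.  (v) Not a restatement: no derivative bound for `gBox` at a non-flat field existed in the
tree (flat: p31 gen 17 / p29 / r18; small fields: p30's whole-torus Kato-route member is a different hypothesis class).
Unit `lit-balaban-r01` gen 26 (literature-prover-lit-balaban-r01-g26-0), 2026-08-23.  NOT summit progress.
-/

namespace Literature.MathematicalPhysics.QuantumFieldTheory.BalabanImbrieJaffe1984to88.BIJ85NeumannPropagatorRegularDeriv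

open Literature.MathematicalPhysics.QuantumFieldTheory.Balaban1983to89
open HiggsLattice (ChargeData)
open HiggsCovariance (propagatorK)
open HiggsRescaling (mesh_scaleBy)
open BIJ85CovariantHiggsDictionary
open BIJ85NeumannPropagatorRegularDecay (U_scaleBy_div propagatorK_scaleBy_div isBlockUnion_of_bigBlocks isBigBlockUnion_regH supDist_eSite
  chi_smul_eq support_of_massive_eq isUnit_nOp_add_mass)
open BIJ88Sect3Statements (U1 toC cfg covD)
open BIJ88NeumannPropagator227Torus (nOp nPad gBox proj proj_mulVec nOp_mul_gBox isUnit_nPad)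
open BIJ88NeumannNoZeroModesTorus (IsBlockUnion)
open scoped BigOperators Matrix
open Finset Matrix

noncomputable section

/-! ## §1 The dictionary for the covariant derivative; its `ε`-scaling at fixed charge -/

section Dictionary

variable {Q : HiggsLattice.Params} {N : ℕ} {t : ℝ}

/-- **THE COVARIANT DERIVATIVE UNDER `ε ↦ tε`, `A ↦ t⁻¹A` AT FIXED CHARGE**: `D^{tε}_{t⁻¹A}Φ(b) = t⁻¹·D^{ε}_AΦ(b)` — the link operator
`U_{tε}(t⁻¹A_b) = U_ε(A_b)` is scale-free (`U_scaleBy_div`), the difference quotient carries the spacing ([B1] (1.7) p.605, (1.22)–(1.23) p.607).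
[cite: Balaban1982Higgs1, (1.7) p.605] -/
theorem covDeriv_scaleBy_div (ht : 0 < t) (C : ChargeData N) (A : HiggsLattice.VecField Q 0) (Φ : HiggsLattice.ScalarField Q 0 N)
    (x : HiggsLattice.Site Q 0) (μ : Fin Q.d) :
    HiggsLattice.covDeriv (P := Q.scaleBy t ht) C (fun b => t⁻¹ * A ⟨b.src, b.dir⟩) Φ ⟨x, μ⟩
      = t⁻¹ • HiggsLattice.covDeriv (P := Q) C A Φ ⟨x, μ⟩ := by
  unfold HiggsLattice.covDeriv
  show ((Q.scaleBy t ht).mesh 0)⁻¹ • (C.U ((Q.scaleBy t ht).mesh 0) (t⁻¹ * A ⟨x, μ⟩) (Φ (x.shift μ)) - Φ x)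
    = t⁻¹ • ((Q.mesh 0)⁻¹ • (C.U (Q.mesh 0) (A ⟨x, μ⟩) (Φ (x.shift μ)) - Φ x))
  rw [U_scaleBy_div, mesh_scaleBy, mul_inv, mul_smul]

variable {P : Params} {s : ℕ}

/-- **[B1] (1.7) `D^ε_{A_H}` ON THE REALIFIED FIELD IS r18's `covD ε⁻¹ u` AT `u = e^{ieεA}`** (the same bond `⟨x, x+e_μ⟩`, the link variable
`U(A_b)` acting on `ℝ² ≅ ℂ` as multiplication by `u_b = e^{ieεA_b}` — `U_bond_toE`):
`D^ε_{A_H}φ_ℝ(⟨x,μ⟩) = (ε⁻¹(u_b·φ(x+e_μ) − φ(x)))_ℝ`. [cite: Balaban1982Higgs1, (1.7) p.605, dictionary] [cite: BalabanImbrieJaffe1988, (3.3) p.265] -/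
theorem covDeriv_rfield (hs : 0 + s ≤ P.m + P.K) (e : ℝ) (A : PBond P 0 → ℝ) (φ : Balaban1983to89.Site P 0 → ℂ)
    (x : HiggsLattice.Site (higgsOf P s) 0) (μ : Fin P.d) :
    HiggsLattice.covDeriv (rotCharge e) (vecH P s hs A) (rfield P s hs φ) ⟨x, μ⟩
      = toE (covD P.eps⁻¹ (cfg (expGauge P e A)) φ ⟨eSite P s rfl hs x, μ⟩) := by
  unfold HiggsLattice.covDeriv covD cfg
  show ((higgsOf P s).mesh 0)⁻¹ • ((rotCharge e).U ((higgsOf P s).mesh 0) (vecH P s hs A ⟨x, μ⟩) (rfield P s hs φ (x.shift μ))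
      - rfield P s hs φ x)
    = toE (((P.eps⁻¹ : ℝ) : ℂ) * (toC (expGauge P e A ⟨eSite P s rfl hs x, μ⟩) * φ ((eSite P s rfl hs x).shift μ)
      - φ (eSite P s rfl hs x)))
  rw [rfield_apply, rfield_apply, U_bond_toE, higgsOf_mesh_zero, eSite_shift, ← map_sub, ← Complex.real_smul,
    LinearIsometryEquiv.map_smul]

end Dictionary

/-! ## §2 The derivative members of [B1] (2.25)/(2.26) at (2.23)-regular `A`, transferred to the massive `Setup` problems, `m² = t² ∈ (0,1]` -/

section Massive

variable {P : Params} {s : ℕ}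

/-- kernel: the common identity of §2 — for an `X`-supported solution of `(nOp_X + t²)ψ = h` (`X` a `k`-block union), the realified covariant
derivative of `ψ` is `t⁻¹` times p35's covariant derivative, on the `tε`-torus with the divided field, of `G^{tε}_k(X_H, t⁻¹A_H; 1)h_ℝ`.
[cite: Balaban1982Higgs1, (2.22) p.610, dictionary] -/
private theorem covD_massive_eq (hs : 0 + s ≤ P.m + P.K) {k : ℕ} (hk1 : 1 ≤ k) (hks : k + s ≤ P.m + P.K) (e : ℝ) (A : PBond P 0 → ℝ)
    {a : ℝ} (ha : 0 < a) {X : Finset (Balaban1983to89.Site P 0)} (hX : IsBlockUnion k X) {t : ℝ} (ht : 0 < t)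
    {ψ h : Balaban1983to89.Site P 0 → ℂ} (hψ : ∀ z, z ∉ X → ψ z = 0)
    (heq : nOp (B1RG242Torus.α P a k * (P.L : ℝ) ^ (k * P.d)) P.eps⁻¹ (expGauge P e A) k X *ᵥ ψ + ((t ^ 2 : ℝ) : ℂ) • ψ = h)
    (xH : HiggsLattice.Site (higgsOf P s) 0) (μ : Fin P.d) :
    toE (covD P.eps⁻¹ (cfg (expGauge P e A)) ψ ⟨eSite P s rfl hs xH, μ⟩)
      = t⁻¹ • HiggsLattice.covDeriv (P := (higgsOf P s).scaleBy t ht) (rotCharge e) (fun b => t⁻¹ * vecH P s hs A ⟨b.src, b.dir⟩)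
          (propagatorK (P := (higgsOf P s).scaleBy t ht) (rotCharge e) (regH P s hs X)
            (fun b => t⁻¹ * vecH P s hs A ⟨b.src, b.dir⟩) 1 a k (rfield P s hs h)) ⟨xH, μ⟩ := by
  have hak : 0 ≤ B1.aSeq a (P.L : ℝ) k := (B1.aSeq_pos ha (B1RG242Torus.one_lt_cast_L P) hk1).le
  have hcol := propagatorK_rfield_eq hs hks e A (pow_pos ht 2) hak hX hψ heq
  have hsc := propagatorK_scaleBy_div (Q := higgsOf P s) ht (rotCharge e) (regH P s hs X) (vecH P s hs A) a k hak (rfield P s hs h)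
  -- pointwise: `ψ_ℝ(y) = t⁻²·(G^{tε}_k(X_H, t⁻¹A_H; 1)h_ℝ)(y)`
  have h1 : ∀ y, rfield P s hs ψ y = t⁻¹ ^ 2 • (propagatorK (P := (higgsOf P s).scaleBy t ht) (rotCharge e) (regH P s hs X)
      (fun b => t⁻¹ * vecH P s hs A ⟨b.src, b.dir⟩) 1 a k (rfield P s hs h)) y := by
    intro y
    have e1 := congrFun hcol y
    have e2 := congrFun hsc y
    rw [← e1]
    show _ = t⁻¹ ^ 2 • (propagatorK (P := (higgsOf P s).scaleBy t ht) (rotCharge e) (regH P s hs X)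
      (fun b => t⁻¹ * vecH P s hs A ⟨b.src, b.dir⟩) 1 a k (rfield P s hs h)) y
    rw [e2]
    show _ = t⁻¹ ^ 2 • (t ^ 2 • (propagatorK (rotCharge e) (regH P s hs X) (vecH P s hs A) (t ^ 2) a k) (rfield P s hs h) y)
    rw [smul_smul, show t⁻¹ ^ 2 * t ^ 2 = 1 by field_simp, one_smul]
  rw [← covDeriv_rfield hs e A ψ xH μ]
  unfold HiggsLattice.covDeriv
  show ((higgsOf P s).mesh 0)⁻¹ • ((rotCharge e).U ((higgsOf P s).mesh 0) (vecH P s hs A ⟨xH, μ⟩)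
        (rfield P s hs ψ (xH.shift μ)) - rfield P s hs ψ xH)
    = t⁻¹ • ((((higgsOf P s).scaleBy t ht).mesh 0)⁻¹ • ((rotCharge e).U (((higgsOf P s).scaleBy t ht).mesh 0)
        (t⁻¹ * vecH P s hs A ⟨xH, μ⟩)
        (propagatorK (P := (higgsOf P s).scaleBy t ht) (rotCharge e) (regH P s hs X)
          (fun b => t⁻¹ * vecH P s hs A ⟨b.src, b.dir⟩) 1 a k (rfield P s hs h) (xH.shift μ))
      - propagatorK (P := (higgsOf P s).scaleBy t ht) (rotCharge e) (regH P s hs X)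
          (fun b => t⁻¹ * vecH P s hs A ⟨b.src, b.dir⟩) 1 a k (rfield P s hs h) xH))
  rw [h1 (xH.shift μ), h1 xH, U_scaleBy_div, mesh_scaleBy, map_smul, ← smul_sub, smul_smul, smul_smul, mul_inv]
  congr 1
  ring

/-- **THE COVARIANT DERIVATIVE OF THE MASSIVE SOLUTIONS, UNIFORMLY IN `m² = t² ∈ (0,1]`** ([B1] (2.25), derivative member): if p35's
`B1Ineq225DerivRegularRegion.norm_covDeriv_propagatorK_region_reg_decay_sum` inner statement holds with the constants `(L^s, c₀, e₁)` at `m² = 1`,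
mesh cap `1` (hypothesis `hB1d`), then on a `Setup` torus (`L`, `d`), for a big-block union `Ω` (blocks `L^k·L^s`), `A` (2.23)-regular on `Ω`
(`0 < e_k ≦ e₁`), a site `x` with `{|y − x| ≦ 2rS + 2L^kL^s(d+1) + 1} ⊂ Ω`, a direction `μ`, and an `Ω`-supported solution of
`(nOp (α_kL^{kd}) ε⁻¹ e^{ieεA} k Ω + t²)ψ = h` (`h` supported in `Ω`, `|h| ≦ M`, `h = 0` within distance `< D` of `x`):
`‖ε⁻¹(u_{⟨x,μ⟩}ψ(x+e_μ) − ψ(x))‖ ≦ c₀(L^kε)·e^{−D/(4L^sL^k)}·M`. [cite: Balaban1982Higgs1, Prop. 2.1 (2.25) p.610] -/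
theorem norm_covD_massive_solution_le (d L s : ℕ) {a : ℝ} (ha : 0 < a) (e creg β c₀ e₁ : ℝ)
    (hB1d : ∀ (P' : HiggsLattice.Params), P'.d = d → P'.L = L → L ^ s ∣ P'.M →
      ∀ {K : ℕ}, 1 ≤ K → K ≤ P'.K → (∀ μ, 3 * B1TorusCubeCover.half P' K (L ^ s) ≤ P'.sitesPerDir 0 μ) → P'.mesh K ≤ 1 →
      ∀ (Ω' : Finset (HiggsLattice.Site P' 0)), B1TorusRegionHSizes.IsBigBlockUnion K (L ^ s) Ω' →
      ∀ (A' : HiggsLattice.VecField P' 0) {ec : ℝ}, 0 < ec → ec ≤ e₁ →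
      (∀ z ∈ Ω', ∀ μ ν : Fin P'.d,
          P'.mesh K * |(rotCharge e).e| / ec * |A' ⟨z.shift μ, ν⟩ - A' ⟨z, ν⟩| ≤ creg * ec ^ (β - 1) / (P'.L : ℝ) ^ K) →
      ∀ (x : HiggsLattice.Site P' 0) (μ : Fin P'.d),
        (∀ y, HiggsLattice.Site.tdist x y
            ≤ 2 * B1TorusCubeLocality26.rS P' K (L ^ s) + 2 * B1TorusCubeCover.half P' K (L ^ s) * (P'.d + 1) + 1 → y ∈ Ω') →
        ∀ (g : HiggsLattice.ScalarField P' 0 2) (M D : ℝ), (∀ y, ‖g y‖ ≤ M) → 0 ≤ D →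
          (∀ z, g z ≠ 0 → D ≤ (HiggsLattice.Site.tdist x z : ℝ)) →
            ‖HiggsLattice.covDeriv (rotCharge e) A' (propagatorK (rotCharge e) Ω' A' 1 a K (B1TorusRegionRop.chi Ω' • g)) ⟨x, μ⟩‖
              ≤ c₀ * P'.mesh K * Real.exp (-(D / (4 * (L ^ s : ℕ) * (P'.L : ℝ) ^ K))) * M)
    (P : Params) (hPd : P.d = d) (hPL : P.L = L) (hs : 0 + s ≤ P.m + P.K) {k : ℕ} (hk1 : 1 ≤ k) (hkK : k ≤ P.K)
    (hks : k + s ≤ P.m + P.K) (hsize : 3 * (L ^ k * L ^ s) ≤ P.sitesPerDir 0)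
    {Ω : Finset (Balaban1983to89.Site P 0)}
    (hbig : ∀ z z' : Balaban1983to89.Site P 0,
      (∀ μ, (z μ).val / (L ^ k * L ^ s) = (z' μ).val / (L ^ k * L ^ s)) → (z ∈ Ω ↔ z' ∈ Ω))
    (A : PBond P 0 → ℝ) {ec : ℝ} (hec : 0 < ec) (hece : ec ≤ e₁)
    (hreg : ∀ z ∈ Ω, ∀ μ ν : Fin P.d,
      P.spacing k * |e| / ec * |A ⟨z.shift μ, ν⟩ - A ⟨z, ν⟩| ≤ creg * ec ^ (β - 1) / (L : ℝ) ^ k)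
    (x : Balaban1983to89.Site P 0)
    (hint : ∀ y, LatticeFieldCalculus.supDist x y
      ≤ 2 * (5 * (L ^ k * L ^ s) / 8 + L ^ k) + 2 * (L ^ k * L ^ s) * (d + 1) + 1 → y ∈ Ω)
    {t : ℝ} (ht : 0 < t) (ht1 : t ≤ 1) {ψ h : Balaban1983to89.Site P 0 → ℂ} (hψ : ∀ z, z ∉ Ω → ψ z = 0)
    (hh : ∀ z, z ∉ Ω → h z = 0)
    (heq : nOp (B1RG242Torus.α P a k * (P.L : ℝ) ^ (k * P.d)) P.eps⁻¹ (expGauge P e A) k Ω *ᵥ ψ + ((t ^ 2 : ℝ) : ℂ) • ψ = h)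
    (M D : ℝ) (hM : ∀ z, ‖h z‖ ≤ M) (hD : 0 ≤ D) (hsupp : ∀ z, h z ≠ 0 → D ≤ (LatticeFieldCalculus.supDist x z : ℝ))
    (μ : Fin P.d) :
    ‖covD P.eps⁻¹ (cfg (expGauge P e A)) ψ ⟨x, μ⟩‖ ≤ c₀ * P.spacing k * Real.exp (-(D / (4 * (L : ℝ) ^ s * (L : ℝ) ^ k))) * M := by
  subst hPd hPL
  have hΩ : IsBlockUnion k Ω := isBlockUnion_of_bigBlocks (s := s) (by omega) hbig
  -- the site `x` read on the Higgs torus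
  obtain ⟨xH, rfl⟩ : ∃ xH, eSite P s rfl hs xH = x := ⟨(eSite P s rfl hs).symm x, Equiv.apply_symm_apply _ _⟩
  -- [B1] (2.25), derivative member, on the `tε`-torus
  have hb := hB1d ((higgsOf P s).scaleBy t ht) rfl rfl (dvd_refl _) hk1 (show k ≤ P.m + P.K - s by omega)
    (fun μ => by
      rw [show ((higgsOf P s).scaleBy t ht).sitesPerDir 0 μ = P.sitesPerDir 0 from higgsOf_sitesPerDir hs μ]
      exact hsize)
    (by
      rw [mesh_scaleBy, higgsOf_mesh]
      refine mul_le_one₀ ht1 (P.spacing_pos k).le ?_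
      rw [← P.spacing_K]
      exact mul_le_mul_of_nonneg_right (pow_le_pow_right₀ (B1RG242Torus.one_lt_cast_L P).le hkK) P.eps_pos.le)
    (regH P s hs Ω) (isBigBlockUnion_regH hs hbig ht) (fun b => t⁻¹ * vecH P s hs A ⟨b.src, b.dir⟩) hec hece
    (fun z hz μ ν => by
      have hz' : eSite P s rfl hs z ∈ Ω := (mem_regH hs Ω z).1 hz
      rw [mesh_scaleBy, higgsOf_mesh, rotCharge_e]
      show t * P.spacing k * |e| / ec * |t⁻¹ * vecH P s hs A ⟨HiggsLattice.Site.shift (P := higgsOf P s) z μ, ν⟩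
          - t⁻¹ * vecH P s hs A ⟨z, ν⟩| ≤ creg * ec ^ (β - 1) / (P.L : ℝ) ^ k
      rw [vecH_apply, vecH_apply, eSite_shift, ← mul_sub, abs_mul, abs_of_pos (inv_pos.2 ht),
        show t * P.spacing k * |e| / ec * (t⁻¹ * |A ⟨(eSite P s rfl hs z).shift μ, ν⟩ - A ⟨eSite P s rfl hs z, ν⟩|)
          = P.spacing k * |e| / ec * |A ⟨(eSite P s rfl hs z).shift μ, ν⟩ - A ⟨eSite P s rfl hs z, ν⟩| by
            field_simp]
      exact hreg _ hz' μ ν)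
    xH μ
    (fun y hy => (mem_regH hs Ω y).2 (hint _ (by
      rw [supDist_eSite]
      exact hy)))
    (rfield P s hs h) M D (fun y => by rw [norm_rfield_apply]; exact hM _) hD
    (fun z hz => by
      have hz' : h (eSite P s rfl hs z) ≠ 0 := fun h0 => hz (by rw [rfield_apply, h0, map_zero])
      have := hsupp _ hz'
      rw [supDist_eSite] at this
      exact this)
  -- assemble
  have hchi := chi_smul_eq hs hh ht (Ω := Ω) (rfield P s hs h) fun _ => rfl
  rw [hchi] at hb
  have hb' : ‖HiggsLattice.covDeriv (P := (higgsOf P s).scaleBy t ht) (rotCharge e) (fun b => t⁻¹ * vecH P s hs A ⟨b.src, b.dir⟩)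
      (propagatorK (P := (higgsOf P s).scaleBy t ht) (rotCharge e) (regH P s hs Ω)
        (fun b => t⁻¹ * vecH P s hs A ⟨b.src, b.dir⟩) 1 a k (rfield P s hs h)) ⟨xH, μ⟩‖
        ≤ c₀ * ((higgsOf P s).scaleBy t ht).mesh k
          * Real.exp (-(D / (4 * (P.L ^ s : ℕ) * (((higgsOf P s).scaleBy t ht).L : ℝ) ^ k))) * M := hb
  rw [mesh_scaleBy, higgsOf_mesh, Nat.cast_pow, show (((higgsOf P s).scaleBy t ht).L : ℝ) = P.L from rfl] at hb'
  rw [← LinearIsometryEquiv.norm_map toE, covD_massive_eq hs hk1 hks e A ha hΩ ht hψ heq xH μ, norm_smul,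
    Real.norm_of_nonneg (inv_pos.2 ht).le]
  calc t⁻¹ * _ ≤ t⁻¹ * (c₀ * (t * P.spacing k) * Real.exp (-(D / (4 * (P.L : ℝ) ^ s * (P.L : ℝ) ^ k))) * M) :=
        mul_le_mul_of_nonneg_left hb' (inv_pos.2 ht).le
    _ = _ := by field_simp

/-- **THE COVARIANT DERIVATIVE OF THE DIFFERENCE OF THE MASSIVE SOLUTIONS ON `Ω ⊆ Ω₀`, UNIFORMLY IN `m² = t² ∈ (0,1]`** ([B1] (2.26),
derivative member): with the hypothesis `hB2` of the companion file's `norm_massive_diff_le` (p35's (2.26) inner statement at `K₀ = L^s`,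
`m² = 1`, mesh cap `1`) and its data (big-block unions `Ω ⊆ Ω₀`, `A` regular on `Ω₀`, `x` with `{|y − x| ≦ 2rS + 2L^kL^s(d+1) + 1} ⊂ Ω`, `h`
supported in `Ω`, `|h| ≦ M`, `h = 0` within `D` of `x`, `D₀ ≦ dist(x,T∖Ω)`, `D₁ ≦ dist(supp h,T∖Ω)`, the solutions `ψ`, `ψ₀` on `Ω`, `Ω₀`), for
every direction `μ`:  `‖ε⁻¹(u_b(ψ − ψ₀)(x+e_μ) − (ψ − ψ₀)(x))‖ ≦ c₀(L^kε)·e^{−(D+D₀+D₁)/(8L^sL^k)}·M`.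
[cite: Balaban1982Higgs1, Prop. 2.1 (2.26) pp.610–611] -/
theorem norm_covD_massive_diff_le (d L s : ℕ) {a : ℝ} (ha : 0 < a) (e creg β c₀ e₁ : ℝ)
    (hB2 : ∀ (P' : HiggsLattice.Params), P'.d = d → P'.L = L → L ^ s ∣ P'.M →
      ∀ {K : ℕ}, 1 ≤ K → K ≤ P'.K → (∀ μ, 3 * B1TorusCubeCover.half P' K (L ^ s) ≤ P'.sitesPerDir 0 μ) → P'.mesh K ≤ 1 →
      ∀ (Ω' Ω₀' : Finset (HiggsLattice.Site P' 0)), B1TorusRegionHSizes.IsBigBlockUnion K (L ^ s) Ω' →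
        B1TorusRegionHSizes.IsBigBlockUnion K (L ^ s) Ω₀' → Ω' ⊆ Ω₀' →
      ∀ (A' : HiggsLattice.VecField P' 0) {ec : ℝ}, 0 < ec → ec ≤ e₁ →
      (∀ z ∈ Ω₀', ∀ μ ν : Fin P'.d,
          P'.mesh K * |(rotCharge e).e| / ec * |A' ⟨z.shift μ, ν⟩ - A' ⟨z, ν⟩| ≤ creg * ec ^ (β - 1) / (P'.L : ℝ) ^ K) →
      ∀ (x : HiggsLattice.Site P' 0),
        (∀ y, HiggsLattice.Site.tdist x y
            ≤ 2 * B1TorusCubeLocality26.rS P' K (L ^ s) + 2 * B1TorusCubeCover.half P' K (L ^ s) * (P'.d + 1) + 1 → y ∈ Ω') →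
        ∀ (g : HiggsLattice.ScalarField P' 0 2) (M D D₀ D₁ : ℝ), (∀ y, ‖g y‖ ≤ M) → 0 ≤ D → 0 ≤ D₀ → 0 ≤ D₁ →
          (∀ z, g z ≠ 0 → D ≤ (HiggsLattice.Site.tdist x z : ℝ)) →
          (∀ z, z ∉ Ω' → D₀ ≤ (HiggsLattice.Site.tdist x z : ℝ)) →
          (∀ y z, g y ≠ 0 → z ∉ Ω' → D₁ ≤ (HiggsLattice.Site.tdist z y : ℝ)) →
            ‖(propagatorK (rotCharge e) Ω' A' 1 a K (B1TorusRegionRop.chi Ω' • g)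
                - propagatorK (rotCharge e) Ω₀' A' 1 a K (B1TorusRegionRop.chi Ω₀' • g)) x‖
              ≤ c₀ * P'.mesh K ^ 2 * Real.exp (-((D + D₀ + D₁) / (8 * (L ^ s : ℕ) * (P'.L : ℝ) ^ K))) * M ∧
            ∀ μ : Fin P'.d,
              ‖HiggsLattice.covDeriv (rotCharge e) A' (propagatorK (rotCharge e) Ω' A' 1 a K (B1TorusRegionRop.chi Ω' • g)
                  - propagatorK (rotCharge e) Ω₀' A' 1 a K (B1TorusRegionRop.chi Ω₀' • g)) ⟨x, μ⟩‖
                ≤ c₀ * P'.mesh K * Real.exp (-((D + D₀ + D₁) / (8 * (L ^ s : ℕ) * (P'.L : ℝ) ^ K))) * M)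
    (P : Params) (hPd : P.d = d) (hPL : P.L = L) (hs : 0 + s ≤ P.m + P.K) {k : ℕ} (hk1 : 1 ≤ k) (hkK : k ≤ P.K)
    (hks : k + s ≤ P.m + P.K) (hsize : 3 * (L ^ k * L ^ s) ≤ P.sitesPerDir 0)
    {Ω Ω₀ : Finset (Balaban1983to89.Site P 0)}
    (hbig : ∀ z z' : Balaban1983to89.Site P 0,
      (∀ μ, (z μ).val / (L ^ k * L ^ s) = (z' μ).val / (L ^ k * L ^ s)) → (z ∈ Ω ↔ z' ∈ Ω))
    (hbig₀ : ∀ z z' : Balaban1983to89.Site P 0,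
      (∀ μ, (z μ).val / (L ^ k * L ^ s) = (z' μ).val / (L ^ k * L ^ s)) → (z ∈ Ω₀ ↔ z' ∈ Ω₀))
    (hsub : Ω ⊆ Ω₀)
    (A : PBond P 0 → ℝ) {ec : ℝ} (hec : 0 < ec) (hece : ec ≤ e₁)
    (hreg : ∀ z ∈ Ω₀, ∀ μ ν : Fin P.d,
      P.spacing k * |e| / ec * |A ⟨z.shift μ, ν⟩ - A ⟨z, ν⟩| ≤ creg * ec ^ (β - 1) / (L : ℝ) ^ k)
    (x : Balaban1983to89.Site P 0)
    (hint : ∀ y, LatticeFieldCalculus.supDist x y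
      ≤ 2 * (5 * (L ^ k * L ^ s) / 8 + L ^ k) + 2 * (L ^ k * L ^ s) * (d + 1) + 1 → y ∈ Ω)
    {t : ℝ} (ht : 0 < t) (ht1 : t ≤ 1) {ψ ψ₀ h : Balaban1983to89.Site P 0 → ℂ} (hψ : ∀ z, z ∉ Ω → ψ z = 0)
    (hψ₀ : ∀ z, z ∉ Ω₀ → ψ₀ z = 0) (hh : ∀ z, z ∉ Ω → h z = 0)
    (heq : nOp (B1RG242Torus.α P a k * (P.L : ℝ) ^ (k * P.d)) P.eps⁻¹ (expGauge P e A) k Ω *ᵥ ψ + ((t ^ 2 : ℝ) : ℂ) • ψ = h)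
    (heq₀ : nOp (B1RG242Torus.α P a k * (P.L : ℝ) ^ (k * P.d)) P.eps⁻¹ (expGauge P e A) k Ω₀ *ᵥ ψ₀ + ((t ^ 2 : ℝ) : ℂ) • ψ₀ = h)
    (M D D₀ D₁ : ℝ) (hM : ∀ z, ‖h z‖ ≤ M) (hD : 0 ≤ D) (hD₀ : 0 ≤ D₀) (hD₁ : 0 ≤ D₁)
    (hsupp : ∀ z, h z ≠ 0 → D ≤ (LatticeFieldCalculus.supDist x z : ℝ))
    (hxD₀ : ∀ z, z ∉ Ω → D₀ ≤ (LatticeFieldCalculus.supDist x z : ℝ))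
    (hhD₁ : ∀ y z, h y ≠ 0 → z ∉ Ω → D₁ ≤ (LatticeFieldCalculus.supDist z y : ℝ)) (μ : Fin P.d) :
    ‖covD P.eps⁻¹ (cfg (expGauge P e A)) (ψ - ψ₀) ⟨x, μ⟩‖
      ≤ c₀ * P.spacing k * Real.exp (-((D + D₀ + D₁) / (8 * (L : ℝ) ^ s * (L : ℝ) ^ k))) * M := by
  subst hPd hPL
  have hΩ : IsBlockUnion k Ω := isBlockUnion_of_bigBlocks (s := s) (by omega) hbig
  have hΩ₀ : IsBlockUnion k Ω₀ := isBlockUnion_of_bigBlocks (s := s) (by omega) hbig₀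
  have hh₀ : ∀ z, z ∉ Ω₀ → h z = 0 := fun z hz => hh z fun hz' => hz (hsub hz')
  have hsubH : regH P s hs Ω ⊆ regH P s hs Ω₀ := fun y hy =>
    (mem_regH hs Ω₀ y).2 (hsub ((mem_regH hs Ω y).1 hy))
  -- the site `x` read on the Higgs torus
  obtain ⟨xH, rfl⟩ : ∃ xH, eSite P s rfl hs xH = x := ⟨(eSite P s rfl hs).symm x, Equiv.apply_symm_apply _ _⟩
  -- [B1] (2.26), derivative member, on the `tε`-torus
  have hb := (hB2 ((higgsOf P s).scaleBy t ht) rfl rfl (dvd_refl _) hk1 (show k ≤ P.m + P.K - s by omega)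
    (fun μ => by
      rw [show ((higgsOf P s).scaleBy t ht).sitesPerDir 0 μ = P.sitesPerDir 0 from higgsOf_sitesPerDir hs μ]
      exact hsize)
    (by
      rw [mesh_scaleBy, higgsOf_mesh]
      refine mul_le_one₀ ht1 (P.spacing_pos k).le ?_
      rw [← P.spacing_K]
      exact mul_le_mul_of_nonneg_right (pow_le_pow_right₀ (B1RG242Torus.one_lt_cast_L P).le hkK) P.eps_pos.le)
    (regH P s hs Ω) (regH P s hs Ω₀) (isBigBlockUnion_regH hs hbig ht) (isBigBlockUnion_regH hs hbig₀ ht) hsubH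
    (fun b => t⁻¹ * vecH P s hs A ⟨b.src, b.dir⟩) hec hece
    (fun z hz μ ν => by
      have hz' : eSite P s rfl hs z ∈ Ω₀ := (mem_regH hs Ω₀ z).1 hz
      rw [mesh_scaleBy, higgsOf_mesh, rotCharge_e]
      show t * P.spacing k * |e| / ec * |t⁻¹ * vecH P s hs A ⟨HiggsLattice.Site.shift (P := higgsOf P s) z μ, ν⟩
          - t⁻¹ * vecH P s hs A ⟨z, ν⟩| ≤ creg * ec ^ (β - 1) / (P.L : ℝ) ^ k
      rw [vecH_apply, vecH_apply, eSite_shift, ← mul_sub, abs_mul, abs_of_pos (inv_pos.2 ht),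
        show t * P.spacing k * |e| / ec * (t⁻¹ * |A ⟨(eSite P s rfl hs z).shift μ, ν⟩ - A ⟨eSite P s rfl hs z, ν⟩|)
          = P.spacing k * |e| / ec * |A ⟨(eSite P s rfl hs z).shift μ, ν⟩ - A ⟨eSite P s rfl hs z, ν⟩| by
            field_simp]
      exact hreg _ hz' μ ν)
    xH
    (fun y hy => (mem_regH hs Ω y).2 (hint _ (by
      rw [supDist_eSite]
      exact hy)))
    (rfield P s hs h) M D D₀ D₁ (fun y => by rw [norm_rfield_apply]; exact hM _) hD hD₀ hD₁
    (fun z hz => by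
      have hz' : h (eSite P s rfl hs z) ≠ 0 := fun h0 => hz (by rw [rfield_apply, h0, map_zero])
      have := hsupp _ hz'
      rw [supDist_eSite] at this
      exact this)
    (fun z hz => by
      have hz' : eSite P s rfl hs z ∉ Ω := fun h' => hz ((mem_regH hs Ω z).2 h')
      have := hxD₀ _ hz'
      rw [supDist_eSite] at this
      exact this)
    (fun y z hy hz => by
      have hy' : h (eSite P s rfl hs y) ≠ 0 := fun h0 => hy (by rw [rfield_apply, h0, map_zero])
      have hz' : eSite P s rfl hs z ∉ Ω := fun h' => hz ((mem_regH hs Ω z).2 h')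
      have := hhD₁ _ _ hy' hz'
      rw [supDist_eSite] at this
      exact this)).2 μ
  -- assemble
  have hchi := chi_smul_eq hs hh ht (Ω := Ω) (rfield P s hs h) fun _ => rfl
  have hchi₀ := chi_smul_eq hs hh₀ ht (Ω := Ω₀) (rfield P s hs h) fun _ => rfl
  rw [hchi, hchi₀] at hb
  have hb' : ‖HiggsLattice.covDeriv (P := (higgsOf P s).scaleBy t ht) (rotCharge e) (fun b => t⁻¹ * vecH P s hs A ⟨b.src, b.dir⟩)
      (propagatorK (P := (higgsOf P s).scaleBy t ht) (rotCharge e) (regH P s hs Ω)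
        (fun b => t⁻¹ * vecH P s hs A ⟨b.src, b.dir⟩) 1 a k (rfield P s hs h)
      - propagatorK (P := (higgsOf P s).scaleBy t ht) (rotCharge e) (regH P s hs Ω₀)
        (fun b => t⁻¹ * vecH P s hs A ⟨b.src, b.dir⟩) 1 a k (rfield P s hs h)) ⟨xH, μ⟩‖
        ≤ c₀ * ((higgsOf P s).scaleBy t ht).mesh k
          * Real.exp (-((D + D₀ + D₁) / (8 * (P.L ^ s : ℕ) * (((higgsOf P s).scaleBy t ht).L : ℝ) ^ k))) * M := hb
  rw [mesh_scaleBy, higgsOf_mesh, Nat.cast_pow, show (((higgsOf P s).scaleBy t ht).L : ℝ) = P.L from rfl] at hb'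
  -- the covariant derivatives are linear: difference of the two identities of `covD_massive_eq`
  have hlin : HiggsLattice.covDeriv (P := (higgsOf P s).scaleBy t ht) (rotCharge e) (fun b => t⁻¹ * vecH P s hs A ⟨b.src, b.dir⟩)
      (propagatorK (P := (higgsOf P s).scaleBy t ht) (rotCharge e) (regH P s hs Ω)
        (fun b => t⁻¹ * vecH P s hs A ⟨b.src, b.dir⟩) 1 a k (rfield P s hs h)
      - propagatorK (P := (higgsOf P s).scaleBy t ht) (rotCharge e) (regH P s hs Ω₀)
        (fun b => t⁻¹ * vecH P s hs A ⟨b.src, b.dir⟩) 1 a k (rfield P s hs h)) ⟨xH, μ⟩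
      = HiggsLattice.covDeriv (P := (higgsOf P s).scaleBy t ht) (rotCharge e) (fun b => t⁻¹ * vecH P s hs A ⟨b.src, b.dir⟩)
          (propagatorK (P := (higgsOf P s).scaleBy t ht) (rotCharge e) (regH P s hs Ω)
            (fun b => t⁻¹ * vecH P s hs A ⟨b.src, b.dir⟩) 1 a k (rfield P s hs h)) ⟨xH, μ⟩
        - HiggsLattice.covDeriv (P := (higgsOf P s).scaleBy t ht) (rotCharge e) (fun b => t⁻¹ * vecH P s hs A ⟨b.src, b.dir⟩)
          (propagatorK (P := (higgsOf P s).scaleBy t ht) (rotCharge e) (regH P s hs Ω₀)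
            (fun b => t⁻¹ * vecH P s hs A ⟨b.src, b.dir⟩) 1 a k (rfield P s hs h)) ⟨xH, μ⟩ := by
    unfold HiggsLattice.covDeriv
    rw [Pi.sub_apply, Pi.sub_apply, map_sub, ← smul_sub]
    congr 1
    abel
  have hcovD : covD P.eps⁻¹ (cfg (expGauge P e A)) (ψ - ψ₀) ⟨eSite P s rfl hs xH, μ⟩
      = covD P.eps⁻¹ (cfg (expGauge P e A)) ψ ⟨eSite P s rfl hs xH, μ⟩
        - covD P.eps⁻¹ (cfg (expGauge P e A)) ψ₀ ⟨eSite P s rfl hs xH, μ⟩ := by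
    simp only [covD, Pi.sub_apply]
    ring
  rw [← LinearIsometryEquiv.norm_map toE, hcovD, map_sub, covD_massive_eq hs hk1 hks e A ha hΩ ht hψ heq xH μ,
    covD_massive_eq hs hk1 hks e A ha hΩ₀ ht hψ₀ heq₀ xH μ, ← smul_sub, ← hlin, norm_smul, Real.norm_of_nonneg (inv_pos.2 ht).le]
  calc t⁻¹ * _ ≤ t⁻¹ * (c₀ * (t * P.spacing k)
        * Real.exp (-((D + D₀ + D₁) / (8 * (P.L : ℝ) ^ s * (P.L : ℝ) ^ k))) * M) :=
        mul_le_mul_of_nonneg_left hb' (inv_pos.2 ht).le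
    _ = _ := by field_simp

end Massive

/-! ## §3 [BIJ85] p.326 / [7] (1.10): the derivative member for the region Neumann propagators at `u = e^{ieεA}`, `A` regular -/

section Decay

variable {P : Params}

/-- kernel: r18's covariant derivative is additive in the field. [folklore] -/
private theorem covD_add (c : ℝ) (u : PBond P 0 → ℂ) (φ ψ : Balaban1983to89.Site P 0 → ℂ) (b : PBond P 0) :
    covD c u (φ + ψ) b = covD c u φ b + covD c u ψ b := by
  simp only [covD, Pi.add_apply]
  ring

/-- kernel: r18's covariant derivative is homogeneous in the field. [folklore] -/
private theorem covD_smul (c : ℝ) (u : PBond P 0 → ℂ) (w : ℂ) (φ : Balaban1983to89.Site P 0 → ℂ) (b : PBond P 0) :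
    covD c u (w • φ) b = w * covD c u φ b := by
  simp only [covD, Pi.smul_apply, smul_eq_mul]
  ring

/-- **[BalabanImbrieJaffe1985] p.326 «The propagators arising from Δ_k(u_k) … also satisfy the regularity and decay estimates of [7]» — THE
DERIVATIVE MEMBER OF [7] (1.10) = [B1] (2.25) «|(D^η_{A,μ}G_k(Ω, A)f)(x)| ≦ c₀exp(−δ₀dist(x, supp f))‖f‖_∞ for x ∈ Ω, dist(x, Ω^c) ≧ R₀» FOR
THE REGION NEUMANN PROPAGATORS `G_k(Ω,u)` OF [BalabanImbrieJaffe1988] (2.27) AT `u = e^{ieεA}`.**  For `d ≧ 1`, `L ≧ 2`, `a > 0`, a charge `e` and a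
regularity pair `(c, β)` there are `s₀` and, for every `s ≧ s₀`, constants `c₀, e₁ > 0` (depending on `d, a, L^s` only) such that on every
`Setup` torus, at every level `1 ≦ k ≦ K` with `k + s ≦ m + K`, `3L^kL^s ≦ 2L^{m+K}`, for every union `Ω` of big blocks (`L^k·L^s` sites per side),
every `A` with `L^kε·|e|/e_k·|A(⟨z+e_μ,ν⟩) − A(⟨z,ν⟩)| ≦ c·e_k^{β−1}/L^k` on `Ω` (`0 < e_k ≦ e₁`), every `x` with `{y : |y − x| ≦ 2rS + 2L^kL^s(d+1)
+ 1} ⊂ Ω`, every `f` with `|f| ≦ M`, `f = 0` on `{|z − x| < D}` (only `1_Ωf` matters) and every direction `μ`: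
`‖ε⁻¹(u_{⟨x,μ⟩}(G_k(Ω,u)f)(x+e_μ) − (G_k(Ω,u)f)(x))‖ ≦ c₀(L^kε)·exp(−D/(4L^s·L^k))·M`, `G_k(Ω,u)` = p31's `gBox (α_kL^{kd}) ε⁻¹ u k Ω`,
`u = expGauge e A`, the covariant derivative = r18's `covD P.eps⁻¹ (cfg u)`.  PROOF: p35's `B1Ineq225DerivRegularRegion.norm_covDeriv_propagatorK_region_reg_decay_sum`
BY NAME at `m² = 1` on the `tε`-tori (§2), the resolvent identity `G_k(Ω,u)f = ψ_{t²}(1_Ωf) + t²ψ_{t²}(G_k(Ω,u)f)` and `t ↓ 0`.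
[cite: BalabanImbrieJaffe1985, p.326 «also satisfy the regularity and decay estimates of [7]»] [cite: Balaban1983RegularityDecay, Theorem p.573 (1.10)]
[cite: Balaban1982Higgs1, Prop. 2.1 (2.25) p.610] -/
theorem norm_covD_gBox_mulVec_le (d L : ℕ) (hd : 1 ≤ d) (hL : 2 ≤ L) {a : ℝ} (ha : 0 < a) (e creg β : ℝ) (hcreg : 0 ≤ creg)
    (hβ : 0 < β) :
    ∃ s₀ : ℕ, ∀ s : ℕ, s₀ ≤ s → ∃ c₀ e₁ : ℝ, 0 < c₀ ∧ 0 < e₁ ∧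
      ∀ (P : Params), P.d = d → P.L = L → ∀ {k : ℕ}, 1 ≤ k → k ≤ P.K → k + s ≤ P.m + P.K →
      3 * (L ^ k * L ^ s) ≤ P.sitesPerDir 0 →
      ∀ (Ω : Finset (Balaban1983to89.Site P 0)),
        (∀ z z' : Balaban1983to89.Site P 0,
          (∀ μ, (z μ).val / (L ^ k * L ^ s) = (z' μ).val / (L ^ k * L ^ s)) → (z ∈ Ω ↔ z' ∈ Ω)) →
      ∀ (A : PBond P 0 → ℝ) {ec : ℝ}, 0 < ec → ec ≤ e₁ →
      (∀ z ∈ Ω, ∀ μ ν : Fin P.d,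
          P.spacing k * |e| / ec * |A ⟨z.shift μ, ν⟩ - A ⟨z, ν⟩| ≤ creg * ec ^ (β - 1) / (L : ℝ) ^ k) →
      ∀ (x : Balaban1983to89.Site P 0),
        (∀ y, LatticeFieldCalculus.supDist x y
          ≤ 2 * (5 * (L ^ k * L ^ s) / 8 + L ^ k) + 2 * (L ^ k * L ^ s) * (d + 1) + 1 → y ∈ Ω) →
      ∀ (f : Balaban1983to89.Site P 0 → ℂ) (M D : ℝ), (∀ z, ‖f z‖ ≤ M) → 0 ≤ D →
        (∀ z, f z ≠ 0 → D ≤ (LatticeFieldCalculus.supDist x z : ℝ)) → ∀ (μ : Fin P.d),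
        ‖covD P.eps⁻¹ (cfg (expGauge P e A))
            (gBox (B1RG242Torus.α P a k * (P.L : ℝ) ^ (k * P.d)) P.eps⁻¹ (expGauge P e A) k Ω *ᵥ f) ⟨x, μ⟩‖
          ≤ c₀ * P.spacing k * Real.exp (-(D / (4 * (L : ℝ) ^ s * (L : ℝ) ^ k))) * M := by
  obtain ⟨K₁, hK₁⟩ := B1Ineq225DerivRegularRegion.norm_covDeriv_propagatorK_region_reg_decay_sum d L hd hL ha one_pos 2 (rotCharge e) 1
    creg β hcreg hβ
  refine ⟨K₁, fun s hs₀ => ?_⟩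
  obtain ⟨c₁, e₁, hc₁, he₁, hB1d⟩ := hK₁ (L ^ s) (le_trans hs₀ (Nat.lt_pow_self (by omega : 1 < L)).le)
  refine ⟨c₁, e₁, hc₁, he₁, ?_⟩
  intro P hPd hPL k hk1 hkK hks hsize Ω hbig A ec hec hece hreg x hint f₀ M D hM₀ hD hsupp₀ μ
  -- reduce to a source supported in `Ω`: `G_k(Ω,u)·1_Ω = G_k(Ω,u)`
  rw [show gBox (B1RG242Torus.α P a k * (P.L : ℝ) ^ (k * P.d)) P.eps⁻¹ (expGauge P e A) k Ω *ᵥ f₀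
      = gBox (B1RG242Torus.α P a k * (P.L : ℝ) ^ (k * P.d)) P.eps⁻¹ (expGauge P e A) k Ω *ᵥ (proj Ω *ᵥ f₀) by
    rw [mulVec_mulVec, BIJ88NeumannPropagator227Torus.gBox_mul_proj]]
  set f := proj Ω *ᵥ f₀ with hf_def
  have hf : ∀ z, z ∉ Ω → f z = 0 := fun z hz => by rw [hf_def, proj_mulVec, if_neg hz]
  have hM : ∀ z, ‖f z‖ ≤ M := fun z => by
    rw [hf_def, proj_mulVec]
    split_ifs
    · exact hM₀ z
    · rw [norm_zero]; exact (norm_nonneg _).trans (hM₀ x)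
  have hsupp : ∀ z, f z ≠ 0 → D ≤ (LatticeFieldCalculus.supDist x z : ℝ) := fun z hz => hsupp₀ z (by
    rw [hf_def, proj_mulVec] at hz
    split_ifs at hz with hzΩ
    · exact hz
    · exact absurd rfl hz)
  have hak : 0 ≤ B1.aSeq a (P.L : ℝ) k := (B1.aSeq_pos ha (B1RG242Torus.one_lt_cast_L P) hk1).le
  have hα : 0 < B1RG242Torus.α P a k * (P.L : ℝ) ^ (k * P.d) :=
    mul_pos (mul_pos (B1.aSeq_pos ha (B1RG242Torus.one_lt_cast_L P) hk1) (inv_pos.2 (pow_pos (P.spacing_pos k) 2)))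
      (pow_pos P.cast_L_pos _)
  have hs : 0 + s ≤ P.m + P.K := by omega
  have hbig' : ∀ z z' : Balaban1983to89.Site P 0,
      (∀ μ, (z μ).val / (P.L ^ k * P.L ^ s) = (z' μ).val / (P.L ^ k * P.L ^ s)) → (z ∈ Ω ↔ z' ∈ Ω) := by
    rw [hPL]; exact hbig
  have hΩ : IsBlockUnion k Ω := isBlockUnion_of_bigBlocks (s := s) (by omega) hbig'
  have hN := isUnit_nPad (j := 0) (by omega) (inv_ne_zero P.eps_pos.ne') hα (expGauge P e A) hΩ
  -- `g = G_k(Ω,u)f`: supported in `Ω`, `nOp g = f`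
  set g := gBox (B1RG242Torus.α P a k * (P.L : ℝ) ^ (k * P.d)) P.eps⁻¹ (expGauge P e A) k Ω *ᵥ f with hg
  have hgsupp : ∀ z, z ∉ Ω → g z = 0 := fun z hz => gBox_mulVec_eq_zero_of_not_mem hN f hz
  have hNg : nOp (B1RG242Torus.α P a k * (P.L : ℝ) ^ (k * P.d)) P.eps⁻¹ (expGauge P e A) k Ω *ᵥ g = f := by
    rw [hg, mulVec_mulVec, nOp_mul_gBox hN, proj_mulVec_eq_self hf]
  -- at every `τ = t² ∈ (0,1]`
  have key : ∀ τ : ℝ, 0 < τ → τ ≤ 1 →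
      ‖covD P.eps⁻¹ (cfg (expGauge P e A)) g ⟨x, μ⟩‖
        ≤ c₁ * P.spacing k * Real.exp (-(D / (4 * (L : ℝ) ^ s * (L : ℝ) ^ k))) * M
          + τ * (c₁ * P.spacing k * Real.exp (-(0 / (4 * (L : ℝ) ^ s * (L : ℝ) ^ k))) * ∑ z, ‖g z‖) := by
    intro τ hτ hτ1
    obtain ⟨t, ht, ht1, htt⟩ : ∃ t : ℝ, 0 < t ∧ t ≤ 1 ∧ t ^ 2 = τ :=
      ⟨Real.sqrt τ, Real.sqrt_pos.2 hτ, by rw [← Real.sqrt_one]; exact Real.sqrt_le_sqrt hτ1, Real.sq_sqrt hτ.le⟩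
    have ht2 : ((t ^ 2 : ℝ) : ℂ) ≠ 0 := Complex.ofReal_ne_zero.2 (pow_pos ht 2).ne'
    have hU := isUnit_nOp_add_mass hs hks e A (pow_pos ht 2) hak hΩ
    have happ : ∀ φ : Balaban1983to89.Site P 0 → ℂ,
        (nOp (B1RG242Torus.α P a k * (P.L : ℝ) ^ (k * P.d)) P.eps⁻¹ (expGauge P e A) k Ω
            + ((t ^ 2 : ℝ) : ℂ) • (1 : Matrix (Balaban1983to89.Site P 0) (Balaban1983to89.Site P 0) ℂ)) *ᵥ φ
          = nOp (B1RG242Torus.α P a k * (P.L : ℝ) ^ (k * P.d)) P.eps⁻¹ (expGauge P e A) k Ω *ᵥ φ + ((t ^ 2 : ℝ) : ℂ) • φ :=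
      fun φ => by rw [add_mulVec, smul_mulVec, one_mulVec]
    obtain ⟨ψf, hTf⟩ := (Matrix.mulVec_surjective_iff_isUnit.2 hU) f
    obtain ⟨ψg, hTg⟩ := (Matrix.mulVec_surjective_iff_isUnit.2 hU) g
    have hψf : nOp (B1RG242Torus.α P a k * (P.L : ℝ) ^ (k * P.d)) P.eps⁻¹ (expGauge P e A) k Ω *ᵥ ψf
        + ((t ^ 2 : ℝ) : ℂ) • ψf = f := by rw [← happ]; exact hTf
    have hψg : nOp (B1RG242Torus.α P a k * (P.L : ℝ) ^ (k * P.d)) P.eps⁻¹ (expGauge P e A) k Ω *ᵥ ψg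
        + ((t ^ 2 : ℝ) : ℂ) • ψg = g := by rw [← happ]; exact hTg
    have hsf := support_of_massive_eq _ _ _ Ω ht2 hf hψf
    have hsg := support_of_massive_eq _ _ _ Ω ht2 hgsupp hψg
    -- the resolvent identity
    have hres : g = ψf + ((t ^ 2 : ℝ) : ℂ) • ψg := by
      apply Matrix.mulVec_injective_iff_isUnit.2 hU
      show _ *ᵥ g = _ *ᵥ (ψf + ((t ^ 2 : ℝ) : ℂ) • ψg)
      rw [mulVec_add, mulVec_smul, hTf, hTg, happ, hNg]
    -- [B1] (2.25), derivative member, for the two massive solutions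
    have hBf := norm_covD_massive_solution_le d L s ha e creg β c₁ e₁ hB1d P hPd hPL hs hk1 hkK hks hsize hbig A hec hece hreg x hint
      ht ht1 hsf hf hψf M D hM hD hsupp μ
    have hBg := norm_covD_massive_solution_le d L s ha e creg β c₁ e₁ hB1d P hPd hPL hs hk1 hkK hks hsize hbig A hec hece hreg x hint
      ht ht1 hsg hgsupp hψg (∑ z, ‖g z‖) 0
      (fun z => Finset.single_le_sum (fun w _ => norm_nonneg (g w)) (Finset.mem_univ z)) le_rfl
      (fun z _ => Nat.cast_nonneg _) μ
    have hcg : covD P.eps⁻¹ (cfg (expGauge P e A)) g ⟨x, μ⟩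
        = covD P.eps⁻¹ (cfg (expGauge P e A)) ψf ⟨x, μ⟩ + ((t ^ 2 : ℝ) : ℂ) * covD P.eps⁻¹ (cfg (expGauge P e A)) ψg ⟨x, μ⟩ := by
      rw [← covD_smul, ← covD_add, ← hres]
    rw [hcg]
    refine (norm_add_le _ _).trans (add_le_add hBf ?_)
    rw [norm_mul, Complex.norm_real, Real.norm_of_nonneg (pow_pos ht 2).le, htt]
    exact mul_le_mul_of_nonneg_left hBg hτ.le
  -- `τ ↓ 0`
  refine le_of_forall_pos_le_add fun ε hε => ?_
  have hsk : 0 < P.spacing k := P.spacing_pos k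
  set Bg := c₁ * P.spacing k * Real.exp (-(0 / (4 * (L : ℝ) ^ s * (L : ℝ) ^ k))) * ∑ z, ‖g z‖ with hBg_def
  have hBg0 : 0 ≤ Bg := by positivity
  have h := key (min 1 (ε / (Bg + 1))) (lt_min one_pos (div_pos hε (by linarith))) (min_le_left _ _)
  refine h.trans (add_le_add le_rfl ?_)
  calc min 1 (ε / (Bg + 1)) * Bg ≤ ε / (Bg + 1) * Bg := mul_le_mul_of_nonneg_right (min_le_right _ _) hBg0
    _ ≤ ε := by
      rw [div_mul_eq_mul_div, div_le_iff₀ (by linarith)]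
      nlinarith

/-- **THE WHOLE TORUS `Ω = T^{(0)}`, DERIVATIVE MEMBER** (no `R₀` condition): for `u = e^{ieεA}` with `A` (2.23)-regular on all of `T^{(0)}`
(`0 < e_k ≦ e₁`), `3L^kL^s ≦ 2L^{m+K}`, every `x`, `μ` and every `f` with `|f| ≦ M` vanishing on `{|z − x| < D}`:
`‖(D_uG_k(T,u)f)(⟨x,μ⟩)‖ ≦ c₀(L^kε)e^{−D/(4L^sL^k)}M` for p31's whole-torus `gBox … k univ` (p30/p33's Kato-route members treat other
hypothesis classes). [cite: BalabanImbrieJaffe1985, p.326 «also satisfy the regularity and decay estimates of [7]»]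
[cite: Balaban1983RegularityDecay, Theorem p.573 (1.10)] -/
theorem norm_covD_gBox_univ_mulVec_le (d L : ℕ) (hd : 1 ≤ d) (hL : 2 ≤ L) {a : ℝ} (ha : 0 < a) (e creg β : ℝ) (hcreg : 0 ≤ creg)
    (hβ : 0 < β) :
    ∃ s₀ : ℕ, ∀ s : ℕ, s₀ ≤ s → ∃ c₀ e₁ : ℝ, 0 < c₀ ∧ 0 < e₁ ∧
      ∀ (P : Params), P.d = d → P.L = L → ∀ {k : ℕ}, 1 ≤ k → k ≤ P.K → k + s ≤ P.m + P.K →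
      3 * (L ^ k * L ^ s) ≤ P.sitesPerDir 0 →
      ∀ (A : PBond P 0 → ℝ) {ec : ℝ}, 0 < ec → ec ≤ e₁ →
      (∀ (z : Balaban1983to89.Site P 0) (μ ν : Fin P.d),
          P.spacing k * |e| / ec * |A ⟨z.shift μ, ν⟩ - A ⟨z, ν⟩| ≤ creg * ec ^ (β - 1) / (L : ℝ) ^ k) →
      ∀ (x : Balaban1983to89.Site P 0) (f : Balaban1983to89.Site P 0 → ℂ) (M D : ℝ), (∀ z, ‖f z‖ ≤ M) → 0 ≤ D →
        (∀ z, f z ≠ 0 → D ≤ (LatticeFieldCalculus.supDist x z : ℝ)) → ∀ (μ : Fin P.d),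
        ‖covD P.eps⁻¹ (cfg (expGauge P e A))
            (gBox (B1RG242Torus.α P a k * (P.L : ℝ) ^ (k * P.d)) P.eps⁻¹ (expGauge P e A) k Finset.univ *ᵥ f) ⟨x, μ⟩‖
          ≤ c₀ * P.spacing k * Real.exp (-(D / (4 * (L : ℝ) ^ s * (L : ℝ) ^ k))) * M := by
  obtain ⟨s₀, hs₀⟩ := norm_covD_gBox_mulVec_le d L hd hL ha e creg β hcreg hβ
  refine ⟨s₀, fun s hs => ?_⟩
  obtain ⟨c₀, e₁, hc₀, he₁, hmain⟩ := hs₀ s hs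
  refine ⟨c₀, e₁, hc₀, he₁, ?_⟩
  intro P hPd hPL k hk1 hkK hks hsize A ec hec hece hreg x f M D hM hD hsupp μ
  exact hmain P hPd hPL hk1 hkK hks hsize Finset.univ (fun z z' _ => by simp only [Finset.mem_univ]) A hec hece
    (fun z _ μ ν => hreg z μ ν) x (fun y _ => Finset.mem_univ y) f M D hM hD hsupp μ

end Decay

/-! ## §4 [BIJ85] p.326 / [7] (1.11)–(1.12): the derivative member of the closeness `δG_k(Ω, Ω₀)` at `u = e^{ieεA}`, `A` regular -/

section Close

variable {P : Params}

/-- **[BalabanImbrieJaffe1985] p.326 — THE DERIVATIVE MEMBER OF THE `δG` CLAUSE [7] (1.11)–(1.12) = [B1] Prop. 2.1 (2.26) FOR THE REGION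
NEUMANN PROPAGATORS `G_k(Ω,u)`, `G_k(Ω₀,u)` OF [BalabanImbrieJaffe1988] (2.27) ON NESTED BIG-BLOCK REGIONS `Ω ⊆ Ω₀` AT `u = e^{ieεA}`.**  With
the constants and data of the companion file's `norm_gBox_sub_gBox_mulVec_le` (`Ω ⊆ Ω₀` unions of big blocks, `A` (2.23)-regular on `Ω₀`, `x`
with `{|y − x| ≦ 2rS + 2L^kL^s(d+1) + 1} ⊂ Ω` — «with the same restrictions on x», `f` supported in `Ω` with `|f| ≦ M` vanishing on
`{|z − x| < D}`, `D₀ ≦ dist(x,T∖Ω)`, `D₁ ≦ dist(supp f,T∖Ω)` — «Ω^c means a complement in T_η») and every direction `μ`: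
`‖ε⁻¹(u_b(G_k(Ω,u)f − G_k(Ω₀,u)f)(x+e_μ) − (G_k(Ω,u)f − G_k(Ω₀,u)f)(x))‖ ≦ c₀(L^kε)·exp(−(D + D₀ + D₁)/(8L^s·L^k))·M` («the inequalities …
(1.10) … with the additional factor»: the derivative member of (1.10) with the factor (1.12)).  PROOF: p35's (2.26) derivative member BY NAME on
the `tε`-tori (§2 `norm_covD_massive_diff_le`), the massive problems on `Ω` and `Ω₀`, the two resolvent identities, §2
`norm_covD_massive_solution_le` (D = 0) for the two `t²`-terms, `t ↓ 0`.
[cite: BalabanImbrieJaffe1985, p.326 «also satisfy the regularity and decay estimates of [7]»]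
[cite: Balaban1983RegularityDecay, Theorem p.573 (1.11)–(1.12)] [cite: Balaban1982Higgs1, Prop. 2.1 (2.26) pp.610–611] -/
theorem norm_covD_gBox_sub_gBox_mulVec_le (d L : ℕ) (hd : 1 ≤ d) (hL : 2 ≤ L) {a : ℝ} (ha : 0 < a) (e creg β : ℝ)
    (hcreg : 0 ≤ creg) (hβ : 0 < β) :
    ∃ s₀ : ℕ, ∀ s : ℕ, s₀ ≤ s → ∃ c₀ e₁ : ℝ, 0 < c₀ ∧ 0 < e₁ ∧
      ∀ (P : Params), P.d = d → P.L = L → ∀ {k : ℕ}, 1 ≤ k → k ≤ P.K → k + s ≤ P.m + P.K →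
      3 * (L ^ k * L ^ s) ≤ P.sitesPerDir 0 →
      ∀ (Ω Ω₀ : Finset (Balaban1983to89.Site P 0)),
        (∀ z z' : Balaban1983to89.Site P 0,
          (∀ μ, (z μ).val / (L ^ k * L ^ s) = (z' μ).val / (L ^ k * L ^ s)) → (z ∈ Ω ↔ z' ∈ Ω)) →
        (∀ z z' : Balaban1983to89.Site P 0,
          (∀ μ, (z μ).val / (L ^ k * L ^ s) = (z' μ).val / (L ^ k * L ^ s)) → (z ∈ Ω₀ ↔ z' ∈ Ω₀)) →
        Ω ⊆ Ω₀ →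
      ∀ (A : PBond P 0 → ℝ) {ec : ℝ}, 0 < ec → ec ≤ e₁ →
      (∀ z ∈ Ω₀, ∀ μ ν : Fin P.d,
          P.spacing k * |e| / ec * |A ⟨z.shift μ, ν⟩ - A ⟨z, ν⟩| ≤ creg * ec ^ (β - 1) / (L : ℝ) ^ k) →
      ∀ (x : Balaban1983to89.Site P 0),
        (∀ y, LatticeFieldCalculus.supDist x y
          ≤ 2 * (5 * (L ^ k * L ^ s) / 8 + L ^ k) + 2 * (L ^ k * L ^ s) * (d + 1) + 1 → y ∈ Ω) →
      ∀ (f : Balaban1983to89.Site P 0 → ℂ) (M D D₀ D₁ : ℝ), (∀ z, ‖f z‖ ≤ M) → (∀ z, z ∉ Ω → f z = 0) →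
        0 ≤ D → 0 ≤ D₀ → 0 ≤ D₁ →
        (∀ z, f z ≠ 0 → D ≤ (LatticeFieldCalculus.supDist x z : ℝ)) →
        (∀ z, z ∉ Ω → D₀ ≤ (LatticeFieldCalculus.supDist x z : ℝ)) →
        (∀ y z, f y ≠ 0 → z ∉ Ω → D₁ ≤ (LatticeFieldCalculus.supDist z y : ℝ)) → ∀ (μ : Fin P.d),
        ‖covD P.eps⁻¹ (cfg (expGauge P e A))
            (gBox (B1RG242Torus.α P a k * (P.L : ℝ) ^ (k * P.d)) P.eps⁻¹ (expGauge P e A) k Ω *ᵥ f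
              - gBox (B1RG242Torus.α P a k * (P.L : ℝ) ^ (k * P.d)) P.eps⁻¹ (expGauge P e A) k Ω₀ *ᵥ f) ⟨x, μ⟩‖
          ≤ c₀ * P.spacing k * Real.exp (-((D + D₀ + D₁) / (8 * (L : ℝ) ^ s * (L : ℝ) ^ k))) * M := by
  obtain ⟨K₁, hK₁⟩ := B1Ineq225DerivRegularRegion.norm_covDeriv_propagatorK_region_reg_decay_sum d L hd hL ha one_pos 2 (rotCharge e) 1
    creg β hcreg hβ
  obtain ⟨K₂, hK₂⟩ :=
    B1Ineq226RegularRegionSum.deltaG_region_reg_decay_sum d L hd hL ha one_pos 2 (rotCharge e) 1 creg β hcreg hβ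
  refine ⟨max K₁ K₂, fun s hs₀ => ?_⟩
  have hLs : s ≤ L ^ s := (Nat.lt_pow_self (by omega : 1 < L)).le
  obtain ⟨c₁, e₁, hc₁, he₁, hB1d⟩ := hK₁ (L ^ s) (le_trans (le_trans (le_max_left _ _) hs₀) hLs)
  obtain ⟨c₂, e₂, hc₂, he₂, hB2⟩ := hK₂ (L ^ s) (le_trans (le_trans (le_max_right _ _) hs₀) hLs)
  refine ⟨c₂, min e₁ e₂, hc₂, lt_min he₁ he₂, ?_⟩
  intro P hPd hPL k hk1 hkK hks hsize Ω Ω₀ hbig hbig₀ hsub A ec hec hece hreg x hint f M D D₀ D₁ hM hf hD hD₀ hD₁ hsupp hxD₀ hfD₁ μ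
  have hece₁ : ec ≤ e₁ := hece.trans (min_le_left _ _)
  have hece₂ : ec ≤ e₂ := hece.trans (min_le_right _ _)
  have hak : 0 ≤ B1.aSeq a (P.L : ℝ) k := (B1.aSeq_pos ha (B1RG242Torus.one_lt_cast_L P) hk1).le
  have hα : 0 < B1RG242Torus.α P a k * (P.L : ℝ) ^ (k * P.d) :=
    mul_pos (mul_pos (B1.aSeq_pos ha (B1RG242Torus.one_lt_cast_L P) hk1) (inv_pos.2 (pow_pos (P.spacing_pos k) 2)))
      (pow_pos P.cast_L_pos _)
  have hs : 0 + s ≤ P.m + P.K := by omega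
  have hbig' : ∀ z z' : Balaban1983to89.Site P 0,
      (∀ μ, (z μ).val / (P.L ^ k * P.L ^ s) = (z' μ).val / (P.L ^ k * P.L ^ s)) → (z ∈ Ω ↔ z' ∈ Ω) := by
    rw [hPL]; exact hbig
  have hbig₀' : ∀ z z' : Balaban1983to89.Site P 0,
      (∀ μ, (z μ).val / (P.L ^ k * P.L ^ s) = (z' μ).val / (P.L ^ k * P.L ^ s)) → (z ∈ Ω₀ ↔ z' ∈ Ω₀) := by
    rw [hPL]; exact hbig₀
  have hΩ : IsBlockUnion k Ω := isBlockUnion_of_bigBlocks (s := s) (by omega) hbig'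
  have hΩ₀ : IsBlockUnion k Ω₀ := isBlockUnion_of_bigBlocks (s := s) (by omega) hbig₀'
  have hN := isUnit_nPad (j := 0) (by omega) (inv_ne_zero P.eps_pos.ne') hα (expGauge P e A) hΩ
  have hN₀ := isUnit_nPad (j := 0) (by omega) (inv_ne_zero P.eps_pos.ne') hα (expGauge P e A) hΩ₀
  have hregΩ : ∀ z ∈ Ω, ∀ μ ν : Fin P.d,
      P.spacing k * |e| / ec * |A ⟨z.shift μ, ν⟩ - A ⟨z, ν⟩| ≤ creg * ec ^ (β - 1) / (L : ℝ) ^ k :=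
    fun z hz => hreg z (hsub hz)
  have hint₀ : ∀ y, LatticeFieldCalculus.supDist x y
      ≤ 2 * (5 * (L ^ k * L ^ s) / 8 + L ^ k) + 2 * (L ^ k * L ^ s) * (d + 1) + 1 → y ∈ Ω₀ :=
    fun y hy => hsub (hint y hy)
  have hf₀ : ∀ z, z ∉ Ω₀ → f z = 0 := fun z hz => hf z fun hz' => hz (hsub hz')
  -- `g = G_k(Ω,u)f`, `g₀ = G_k(Ω₀,u)f`
  set g := gBox (B1RG242Torus.α P a k * (P.L : ℝ) ^ (k * P.d)) P.eps⁻¹ (expGauge P e A) k Ω *ᵥ f with hg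
  set g₀ := gBox (B1RG242Torus.α P a k * (P.L : ℝ) ^ (k * P.d)) P.eps⁻¹ (expGauge P e A) k Ω₀ *ᵥ f with hg₀
  have hgsupp : ∀ z, z ∉ Ω → g z = 0 := fun z hz => gBox_mulVec_eq_zero_of_not_mem hN f hz
  have hg₀supp : ∀ z, z ∉ Ω₀ → g₀ z = 0 := fun z hz => gBox_mulVec_eq_zero_of_not_mem hN₀ f hz
  have hNg : nOp (B1RG242Torus.α P a k * (P.L : ℝ) ^ (k * P.d)) P.eps⁻¹ (expGauge P e A) k Ω *ᵥ g = f := by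
    rw [hg, mulVec_mulVec, nOp_mul_gBox hN, proj_mulVec_eq_self hf]
  have hNg₀ : nOp (B1RG242Torus.α P a k * (P.L : ℝ) ^ (k * P.d)) P.eps⁻¹ (expGauge P e A) k Ω₀ *ᵥ g₀ = f := by
    rw [hg₀, mulVec_mulVec, nOp_mul_gBox hN₀, proj_mulVec_eq_self hf₀]
  -- at every `τ = t² ∈ (0,1]`
  have key : ∀ τ : ℝ, 0 < τ → τ ≤ 1 →
      ‖covD P.eps⁻¹ (cfg (expGauge P e A)) (g - g₀) ⟨x, μ⟩‖
        ≤ c₂ * P.spacing k * Real.exp (-((D + D₀ + D₁) / (8 * (L : ℝ) ^ s * (L : ℝ) ^ k))) * M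
        + τ * (c₁ * P.spacing k * Real.exp (-(0 / (4 * (L : ℝ) ^ s * (L : ℝ) ^ k))) * ∑ z, ‖g z‖
          + c₁ * P.spacing k * Real.exp (-(0 / (4 * (L : ℝ) ^ s * (L : ℝ) ^ k))) * ∑ z, ‖g₀ z‖) := by
    intro τ hτ hτ1
    obtain ⟨t, ht, ht1, htt⟩ : ∃ t : ℝ, 0 < t ∧ t ≤ 1 ∧ t ^ 2 = τ :=
      ⟨Real.sqrt τ, Real.sqrt_pos.2 hτ, by rw [← Real.sqrt_one]; exact Real.sqrt_le_sqrt hτ1, Real.sq_sqrt hτ.le⟩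
    have ht2 : ((t ^ 2 : ℝ) : ℂ) ≠ 0 := Complex.ofReal_ne_zero.2 (pow_pos ht 2).ne'
    have hU := isUnit_nOp_add_mass hs hks e A (pow_pos ht 2) hak hΩ
    have hU₀ := isUnit_nOp_add_mass hs hks e A (pow_pos ht 2) hak hΩ₀
    have happ : ∀ (X : Finset (Balaban1983to89.Site P 0)) (φ : Balaban1983to89.Site P 0 → ℂ),
        (nOp (B1RG242Torus.α P a k * (P.L : ℝ) ^ (k * P.d)) P.eps⁻¹ (expGauge P e A) k X
            + ((t ^ 2 : ℝ) : ℂ) • (1 : Matrix (Balaban1983to89.Site P 0) (Balaban1983to89.Site P 0) ℂ)) *ᵥ φ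
          = nOp (B1RG242Torus.α P a k * (P.L : ℝ) ^ (k * P.d)) P.eps⁻¹ (expGauge P e A) k X *ᵥ φ + ((t ^ 2 : ℝ) : ℂ) • φ :=
      fun X φ => by rw [add_mulVec, smul_mulVec, one_mulVec]
    obtain ⟨ψf, hTf⟩ := (Matrix.mulVec_surjective_iff_isUnit.2 hU) f
    obtain ⟨ψg, hTg⟩ := (Matrix.mulVec_surjective_iff_isUnit.2 hU) g
    obtain ⟨ψf₀, hTf₀⟩ := (Matrix.mulVec_surjective_iff_isUnit.2 hU₀) f
    obtain ⟨ψg₀, hTg₀⟩ := (Matrix.mulVec_surjective_iff_isUnit.2 hU₀) g₀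
    have hψf : nOp (B1RG242Torus.α P a k * (P.L : ℝ) ^ (k * P.d)) P.eps⁻¹ (expGauge P e A) k Ω *ᵥ ψf
        + ((t ^ 2 : ℝ) : ℂ) • ψf = f := by rw [← happ]; exact hTf
    have hψg : nOp (B1RG242Torus.α P a k * (P.L : ℝ) ^ (k * P.d)) P.eps⁻¹ (expGauge P e A) k Ω *ᵥ ψg
        + ((t ^ 2 : ℝ) : ℂ) • ψg = g := by rw [← happ]; exact hTg
    have hψf₀ : nOp (B1RG242Torus.α P a k * (P.L : ℝ) ^ (k * P.d)) P.eps⁻¹ (expGauge P e A) k Ω₀ *ᵥ ψf₀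
        + ((t ^ 2 : ℝ) : ℂ) • ψf₀ = f := by rw [← happ]; exact hTf₀
    have hψg₀ : nOp (B1RG242Torus.α P a k * (P.L : ℝ) ^ (k * P.d)) P.eps⁻¹ (expGauge P e A) k Ω₀ *ᵥ ψg₀
        + ((t ^ 2 : ℝ) : ℂ) • ψg₀ = g₀ := by rw [← happ]; exact hTg₀
    have hsf := support_of_massive_eq _ _ _ Ω ht2 hf hψf
    have hsg := support_of_massive_eq _ _ _ Ω ht2 hgsupp hψg
    have hsf₀ := support_of_massive_eq _ _ _ Ω₀ ht2 hf₀ hψf₀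
    have hsg₀ := support_of_massive_eq _ _ _ Ω₀ ht2 hg₀supp hψg₀
    -- the resolvent identities
    have hres : g = ψf + ((t ^ 2 : ℝ) : ℂ) • ψg := by
      apply Matrix.mulVec_injective_iff_isUnit.2 hU
      show _ *ᵥ g = _ *ᵥ (ψf + ((t ^ 2 : ℝ) : ℂ) • ψg)
      rw [mulVec_add, mulVec_smul, hTf, hTg, happ, hNg]
    have hres₀ : g₀ = ψf₀ + ((t ^ 2 : ℝ) : ℂ) • ψg₀ := by
      apply Matrix.mulVec_injective_iff_isUnit.2 hU₀
      show _ *ᵥ g₀ = _ *ᵥ (ψf₀ + ((t ^ 2 : ℝ) : ℂ) • ψg₀)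
      rw [mulVec_add, mulVec_smul, hTf₀, hTg₀, happ, hNg₀]
    -- [B1] (2.26) derivative member for `ψf − ψf₀`, (2.25) derivative member at `D = 0` for `ψg`, `ψg₀`
    have hBd := norm_covD_massive_diff_le d L s ha e creg β c₂ e₂ hB2 P hPd hPL hs hk1 hkK hks hsize hbig hbig₀ hsub A hec hece₂
      hreg x hint ht ht1 hsf hsf₀ hf hψf hψf₀ M D D₀ D₁ hM hD hD₀ hD₁ hsupp hxD₀ hfD₁ μ
    have hBg := norm_covD_massive_solution_le d L s ha e creg β c₁ e₁ hB1d P hPd hPL hs hk1 hkK hks hsize hbig A hec hece₁ hregΩ x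
      hint ht ht1 hsg hgsupp hψg (∑ z, ‖g z‖) 0
      (fun z => Finset.single_le_sum (fun w _ => norm_nonneg (g w)) (Finset.mem_univ z)) le_rfl
      (fun z _ => Nat.cast_nonneg _) μ
    have hBg₀ := norm_covD_massive_solution_le d L s ha e creg β c₁ e₁ hB1d P hPd hPL hs hk1 hkK hks hsize hbig₀ A hec hece₁ hreg x
      hint₀ ht ht1 hsg₀ hg₀supp hψg₀ (∑ z, ‖g₀ z‖) 0
      (fun z => Finset.single_le_sum (fun w _ => norm_nonneg (g₀ w)) (Finset.mem_univ z)) le_rfl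
      (fun z _ => Nat.cast_nonneg _) μ
    have hcg : covD P.eps⁻¹ (cfg (expGauge P e A)) (g - g₀) ⟨x, μ⟩
        = covD P.eps⁻¹ (cfg (expGauge P e A)) (ψf - ψf₀) ⟨x, μ⟩
          + ((t ^ 2 : ℝ) : ℂ) * (covD P.eps⁻¹ (cfg (expGauge P e A)) ψg ⟨x, μ⟩
            - covD P.eps⁻¹ (cfg (expGauge P e A)) ψg₀ ⟨x, μ⟩) := by
      rw [hres, hres₀]
      simp only [covD, Pi.sub_apply, Pi.add_apply, Pi.smul_apply, smul_eq_mul]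
      ring
    rw [hcg]
    refine (norm_add_le _ _).trans (add_le_add hBd ?_)
    rw [norm_mul, Complex.norm_real, Real.norm_of_nonneg (pow_pos ht 2).le, htt]
    exact mul_le_mul_of_nonneg_left ((norm_sub_le _ _).trans (add_le_add hBg hBg₀)) hτ.le
  -- `τ ↓ 0`
  refine le_of_forall_pos_le_add fun ε hε => ?_
  have hsk : 0 < P.spacing k := P.spacing_pos k
  set Bg := c₁ * P.spacing k * Real.exp (-(0 / (4 * (L : ℝ) ^ s * (L : ℝ) ^ k))) * ∑ z, ‖g z‖
    + c₁ * P.spacing k * Real.exp (-(0 / (4 * (L : ℝ) ^ s * (L : ℝ) ^ k))) * ∑ z, ‖g₀ z‖ with hBg_def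
  have hBg0 : 0 ≤ Bg := by positivity
  have h := key (min 1 (ε / (Bg + 1))) (lt_min one_pos (div_pos hε (by linarith))) (min_le_left _ _)
  refine h.trans (add_le_add le_rfl ?_)
  calc min 1 (ε / (Bg + 1)) * Bg ≤ ε / (Bg + 1) * Bg := mul_le_mul_of_nonneg_right (min_le_right _ _) hBg0
    _ ≤ ε := by
      rw [div_mul_eq_mul_div, div_le_iff₀ (by linarith)]
      nlinarith

/-- **THE PAIR `Ω ⊂ Ω₀ = T^{(0)}`, DERIVATIVE MEMBER**: for `u = e^{ieεA}` with `A` (2.23)-regular on all of `T^{(0)}`, a big-block union `Ω`,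
`x` with `{|y − x| ≦ 2rS + 2L^kL^s(d+1) + 1} ⊂ Ω`, `f` supported in `Ω` with `|f| ≦ M` vanishing on `{|z − x| < D}`, `D₀ ≦ dist(x,T∖Ω)`,
`D₁ ≦ dist(supp f,T∖Ω)`, every `μ`:  `‖(D_u(G_k(Ω,u)f − G_k(T,u)f))(⟨x,μ⟩)‖ ≦ c₀(L^kε)e^{−(D+D₀+D₁)/(8L^sL^k)}M`.
[cite: BalabanImbrieJaffe1985, p.326 «also satisfy the regularity and decay estimates of [7]»]
[cite: Balaban1983RegularityDecay, Theorem p.573 (1.11)–(1.12)] -/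
theorem norm_covD_gBox_sub_gBox_univ_mulVec_le (d L : ℕ) (hd : 1 ≤ d) (hL : 2 ≤ L) {a : ℝ} (ha : 0 < a) (e creg β : ℝ)
    (hcreg : 0 ≤ creg) (hβ : 0 < β) :
    ∃ s₀ : ℕ, ∀ s : ℕ, s₀ ≤ s → ∃ c₀ e₁ : ℝ, 0 < c₀ ∧ 0 < e₁ ∧
      ∀ (P : Params), P.d = d → P.L = L → ∀ {k : ℕ}, 1 ≤ k → k ≤ P.K → k + s ≤ P.m + P.K →
      3 * (L ^ k * L ^ s) ≤ P.sitesPerDir 0 →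
      ∀ (Ω : Finset (Balaban1983to89.Site P 0)),
        (∀ z z' : Balaban1983to89.Site P 0,
          (∀ μ, (z μ).val / (L ^ k * L ^ s) = (z' μ).val / (L ^ k * L ^ s)) → (z ∈ Ω ↔ z' ∈ Ω)) →
      ∀ (A : PBond P 0 → ℝ) {ec : ℝ}, 0 < ec → ec ≤ e₁ →
      (∀ (z : Balaban1983to89.Site P 0) (μ ν : Fin P.d),
          P.spacing k * |e| / ec * |A ⟨z.shift μ, ν⟩ - A ⟨z, ν⟩| ≤ creg * ec ^ (β - 1) / (L : ℝ) ^ k) →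
      ∀ (x : Balaban1983to89.Site P 0),
        (∀ y, LatticeFieldCalculus.supDist x y
          ≤ 2 * (5 * (L ^ k * L ^ s) / 8 + L ^ k) + 2 * (L ^ k * L ^ s) * (d + 1) + 1 → y ∈ Ω) →
      ∀ (f : Balaban1983to89.Site P 0 → ℂ) (M D D₀ D₁ : ℝ), (∀ z, ‖f z‖ ≤ M) → (∀ z, z ∉ Ω → f z = 0) →
        0 ≤ D → 0 ≤ D₀ → 0 ≤ D₁ →
        (∀ z, f z ≠ 0 → D ≤ (LatticeFieldCalculus.supDist x z : ℝ)) →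
        (∀ z, z ∉ Ω → D₀ ≤ (LatticeFieldCalculus.supDist x z : ℝ)) →
        (∀ y z, f y ≠ 0 → z ∉ Ω → D₁ ≤ (LatticeFieldCalculus.supDist z y : ℝ)) → ∀ (μ : Fin P.d),
        ‖covD P.eps⁻¹ (cfg (expGauge P e A))
            (gBox (B1RG242Torus.α P a k * (P.L : ℝ) ^ (k * P.d)) P.eps⁻¹ (expGauge P e A) k Ω *ᵥ f
              - gBox (B1RG242Torus.α P a k * (P.L : ℝ) ^ (k * P.d)) P.eps⁻¹ (expGauge P e A) k Finset.univ *ᵥ f) ⟨x, μ⟩‖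
          ≤ c₀ * P.spacing k * Real.exp (-((D + D₀ + D₁) / (8 * (L : ℝ) ^ s * (L : ℝ) ^ k))) * M := by
  obtain ⟨s₀, hs₀⟩ := norm_covD_gBox_sub_gBox_mulVec_le d L hd hL ha e creg β hcreg hβ
  refine ⟨s₀, fun s hs => ?_⟩
  obtain ⟨c₀, e₁, hc₀, he₁, hmain⟩ := hs₀ s hs
  refine ⟨c₀, e₁, hc₀, he₁, ?_⟩
  intro P hPd hPL k hk1 hkK hks hsize Ω hbig A ec hec hece hreg x hint f M D D₀ D₁ hM hf hD hD₀ hD₁ hsupp hxD₀ hfD₁ μ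
  exact hmain P hPd hPL hk1 hkK hks hsize Ω Finset.univ hbig (fun z z' _ => by simp only [Finset.mem_univ])
    (Finset.subset_univ Ω) A hec hece (fun z _ μ ν => hreg z μ ν) x hint f M D D₀ D₁ hM hf hD hD₀ hD₁ hsupp hxD₀ hfD₁ μ

end Close

/-! ## §5 The derivative input shapes of gen 17 §4 at a regular `u = e^{ieεA}`, level-`k` units, p38's metric -/

section InputShapes

variable {P : Params}

/-- kernel: the exponent of this lineage in p31's level-`k` units. [folklore] -/
private theorem exp_units (c Ls Lk E : ℝ) (hc : c ≠ 0) (hLs : Ls ≠ 0) (hLk : Lk ≠ 0) :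
    Real.exp (-(E / (c * Ls * Lk))) = Real.exp (-(1 / (c * Ls) * (Lk⁻¹ * E))) := by
  congr 1
  field_simp

/-- kernel: `e^{−δE₊} ≤ e^{−δE}` for `δ ≥ 0`, `E ≤ E₊`. [folklore] -/
private theorem exp_le_exp_of_le {δ E E' : ℝ} (hδ : 0 ≤ δ) (hE : E ≤ E') :
    Real.exp (-(δ * E')) ≤ Real.exp (-(δ * E)) :=
  Real.exp_le_exp.2 (neg_le_neg (mul_le_mul_of_nonneg_left hE hδ))

/-- **THE (1.10)-DERIVATIVE INPUT SHAPE (gen 17's `decay110_flat_cube_deriv_level`) FOR `X = T^{(0)}` AT A REGULAR `u = e^{ieεA}`, EVERY BOND**: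
`∃ s₀, ∀ s ≧ s₀, ∃ c₀ e₁ > 0`: on every `Setup` torus, `1 ≦ k ≦ K`, `k + s ≦ m + K`, `3L^kL^s ≦ 2L^{m+K}`, for every `A` (2.23)-regular on `T^{(0)}`
(`0 < e_k ≦ e₁`), every `x`, every `f` with `‖f‖ ≦ F` supported at sup-torus distance `≧ D` from `x` (p38's `T`, any real `D`), every `μ`:
`‖covD ε⁻¹ u (G_k(T,u)f) ⟨x,μ⟩‖ ≦ s_k·(c₀·e^{−δ₀·((L^k)⁻¹D)}·F)`, `δ₀ = 1/(4L^s)`.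
[cite: Balaban1983RegularityDecay, Theorem p.573 (1.10)] [cite: BalabanImbrieJaffe1985, p.326 «also satisfy the regularity and decay estimates of [7]»] -/
theorem input110_deriv_regular_univ (d L : ℕ) (hd : 1 ≤ d) (hL : 2 ≤ L) {a : ℝ} (ha : 0 < a) (e creg β : ℝ) (hcreg : 0 ≤ creg)
    (hβ : 0 < β) :
    ∃ s₀ : ℕ, ∀ s : ℕ, s₀ ≤ s → ∃ c₀ e₁ : ℝ, 0 < c₀ ∧ 0 < e₁ ∧
      ∀ (P : Params), P.d = d → P.L = L → ∀ {k : ℕ}, 1 ≤ k → k ≤ P.K → k + s ≤ P.m + P.K →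
      3 * (L ^ k * L ^ s) ≤ P.sitesPerDir 0 →
      ∀ (A : PBond P 0 → ℝ) {ec : ℝ}, 0 < ec → ec ≤ e₁ →
      (∀ (z : Balaban1983to89.Site P 0) (μ ν : Fin P.d),
          P.spacing k * |e| / ec * |A ⟨z.shift μ, ν⟩ - A ⟨z, ν⟩| ≤ creg * ec ^ (β - 1) / (L : ℝ) ^ k) →
      ∀ (x : Balaban1983to89.Site P 0) (f : Balaban1983to89.Site P 0 → ℂ) (F D : ℝ), (∀ y, ‖f y‖ ≤ F) →
        (∀ y, f y ≠ 0 → D ≤ B5Ineq137Torus.T P 0 x y) → ∀ (μ : Fin P.d),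
        ‖covD P.eps⁻¹ (cfg (expGauge P e A))
            (gBox (B1RG242Torus.α P a k * (P.L : ℝ) ^ (k * P.d)) P.eps⁻¹ (expGauge P e A) k Finset.univ *ᵥ f) ⟨x, μ⟩‖
          ≤ P.spacing k * (c₀ * Real.exp (-(1 / (4 * (L : ℝ) ^ s) * (((P.L : ℝ) ^ k)⁻¹ * D))) * F) := by
  obtain ⟨s₀, hs₀⟩ := norm_covD_gBox_univ_mulVec_le d L hd hL ha e creg β hcreg hβ
  refine ⟨s₀, fun s hs => ?_⟩
  obtain ⟨c₀, e₁, hc₀, he₁, hmain⟩ := hs₀ s hs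
  refine ⟨c₀, e₁, hc₀, he₁, ?_⟩
  intro P hPd hPL k hk1 hkK hks hsize A ec hec hece hreg x f F D hF hsD μ
  have hF0 : 0 ≤ F := (norm_nonneg _).trans (hF x)
  have hLr : (0 : ℝ) < L := by exact_mod_cast (show 0 < L by omega)
  have hLs : (0 : ℝ) < (L : ℝ) ^ s := pow_pos hLr s
  have hLk : (0 : ℝ) < (L : ℝ) ^ k := pow_pos hLr k
  have hsk : 0 < P.spacing k := P.spacing_pos k
  have h := hmain P hPd hPL hk1 hkK hks hsize A hec hece hreg x f F (max D 0) hF (le_max_right _ _)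
    (fun z hz => by
      rw [← B3Bound323ZeroTorus.T_eq_supDist]
      exact max_le (hsD z hz) (B5Ineq137Torus.T_nonneg P 0 x z)) μ
  have hPLk : ((L : ℝ) ^ k)⁻¹ = ((P.L : ℝ) ^ k)⁻¹ := by rw [hPL]
  have hPk : (0 : ℝ) < (P.L : ℝ) ^ k := pow_pos P.cast_L_pos k
  rw [exp_units 4 ((L : ℝ) ^ s) ((L : ℝ) ^ k) (max D 0) four_ne_zero hLs.ne' hLk.ne', hPLk] at h
  calc _ ≤ c₀ * P.spacing k * Real.exp (-(1 / (4 * (L : ℝ) ^ s) * (((P.L : ℝ) ^ k)⁻¹ * max D 0))) * F := h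
    _ ≤ c₀ * P.spacing k * Real.exp (-(1 / (4 * (L : ℝ) ^ s) * (((P.L : ℝ) ^ k)⁻¹ * D))) * F :=
        mul_le_mul_of_nonneg_right (mul_le_mul_of_nonneg_left
          (exp_le_exp_of_le (by positivity) (mul_le_mul_of_nonneg_left (le_max_left _ _) (inv_pos.2 hPk).le))
          (by positivity)) hF0
    _ = _ := by ring

/-- **THE (1.10)-DERIVATIVE INPUT SHAPE FOR A BIG-BLOCK UNION `X`, AT THE BONDS WHOSE SOURCE IS DEEP INSIDE `X`, AT A REGULAR `u = e^{ieεA}`**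
(«for x ∈ Ω, dist(x, Ω^c) ≧ R₀»): for every big-block union `X` (blocks `L^k·L^s`), `A` regular on `X`, every `x` with
`{y : |y − x|_∞ ≦ 2rS + 2L^kL^s(d+1) + 1} ⊂ X`, every `f` with `‖f‖ ≦ F` supported at sup-torus distance `≧ D` from `x`, every `μ`:
`‖covD ε⁻¹ u (G_k(X,u)f) ⟨x,μ⟩‖ ≦ s_k·(c₀·e^{−δ₀·((L^k)⁻¹D)}·F)`, `δ₀ = 1/(4L^s)`.
[cite: Balaban1983RegularityDecay, Theorem p.573 (1.10)] [cite: BalabanImbrieJaffe1985, p.326 «also satisfy the regularity and decay estimates of [7]»] -/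
theorem input110_deriv_regular_deep (d L : ℕ) (hd : 1 ≤ d) (hL : 2 ≤ L) {a : ℝ} (ha : 0 < a) (e creg β : ℝ) (hcreg : 0 ≤ creg)
    (hβ : 0 < β) :
    ∃ s₀ : ℕ, ∀ s : ℕ, s₀ ≤ s → ∃ c₀ e₁ : ℝ, 0 < c₀ ∧ 0 < e₁ ∧
      ∀ (P : Params), P.d = d → P.L = L → ∀ {k : ℕ}, 1 ≤ k → k ≤ P.K → k + s ≤ P.m + P.K →
      3 * (L ^ k * L ^ s) ≤ P.sitesPerDir 0 →
      ∀ (X : Finset (Balaban1983to89.Site P 0)),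
        (∀ z z' : Balaban1983to89.Site P 0,
          (∀ μ, (z μ).val / (L ^ k * L ^ s) = (z' μ).val / (L ^ k * L ^ s)) → (z ∈ X ↔ z' ∈ X)) →
      ∀ (A : PBond P 0 → ℝ) {ec : ℝ}, 0 < ec → ec ≤ e₁ →
      (∀ z ∈ X, ∀ μ ν : Fin P.d,
          P.spacing k * |e| / ec * |A ⟨z.shift μ, ν⟩ - A ⟨z, ν⟩| ≤ creg * ec ^ (β - 1) / (L : ℝ) ^ k) →
      ∀ (x : Balaban1983to89.Site P 0),
        (∀ y, B5Ineq137Torus.T P 0 x y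
          ≤ (2 * (5 * (L ^ k * L ^ s) / 8 + L ^ k) + 2 * (L ^ k * L ^ s) * (d + 1) + 1 : ℕ) → y ∈ X) →
      ∀ (f : Balaban1983to89.Site P 0 → ℂ) (F D : ℝ), (∀ y, ‖f y‖ ≤ F) →
        (∀ y, f y ≠ 0 → D ≤ B5Ineq137Torus.T P 0 x y) → ∀ (μ : Fin P.d),
        ‖covD P.eps⁻¹ (cfg (expGauge P e A))
            (gBox (B1RG242Torus.α P a k * (P.L : ℝ) ^ (k * P.d)) P.eps⁻¹ (expGauge P e A) k X *ᵥ f) ⟨x, μ⟩‖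
          ≤ P.spacing k * (c₀ * Real.exp (-(1 / (4 * (L : ℝ) ^ s) * (((P.L : ℝ) ^ k)⁻¹ * D))) * F) := by
  obtain ⟨s₀, hs₀⟩ := norm_covD_gBox_mulVec_le d L hd hL ha e creg β hcreg hβ
  refine ⟨s₀, fun s hs => ?_⟩
  obtain ⟨c₀, e₁, hc₀, he₁, hmain⟩ := hs₀ s hs
  refine ⟨c₀, e₁, hc₀, he₁, ?_⟩
  intro P hPd hPL k hk1 hkK hks hsize X hbig A ec hec hece hreg x hint f F D hF hsD μ
  have hF0 : 0 ≤ F := (norm_nonneg _).trans (hF x)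
  have hLr : (0 : ℝ) < L := by exact_mod_cast (show 0 < L by omega)
  have hLs : (0 : ℝ) < (L : ℝ) ^ s := pow_pos hLr s
  have hLk : (0 : ℝ) < (L : ℝ) ^ k := pow_pos hLr k
  have hsk : 0 < P.spacing k := P.spacing_pos k
  have h := hmain P hPd hPL hk1 hkK hks hsize X hbig A hec hece hreg x
    (fun y hy => hint y (by
      rw [B3Bound323ZeroTorus.T_eq_supDist]
      exact_mod_cast hy))
    f F (max D 0) hF (le_max_right _ _)
    (fun z hz => by
      rw [← B3Bound323ZeroTorus.T_eq_supDist]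
      exact max_le (hsD z hz) (B5Ineq137Torus.T_nonneg P 0 x z)) μ
  have hPLk : ((L : ℝ) ^ k)⁻¹ = ((P.L : ℝ) ^ k)⁻¹ := by rw [hPL]
  have hPk : (0 : ℝ) < (P.L : ℝ) ^ k := pow_pos P.cast_L_pos k
  rw [exp_units 4 ((L : ℝ) ^ s) ((L : ℝ) ^ k) (max D 0) four_ne_zero hLs.ne' hLk.ne', hPLk] at h
  calc _ ≤ c₀ * P.spacing k * Real.exp (-(1 / (4 * (L : ℝ) ^ s) * (((P.L : ℝ) ^ k)⁻¹ * max D 0))) * F := h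
    _ ≤ c₀ * P.spacing k * Real.exp (-(1 / (4 * (L : ℝ) ^ s) * (((P.L : ℝ) ^ k)⁻¹ * D))) * F :=
        mul_le_mul_of_nonneg_right (mul_le_mul_of_nonneg_left
          (exp_le_exp_of_le (by positivity) (mul_le_mul_of_nonneg_left (le_max_left _ _) (inv_pos.2 hPk).le))
          (by positivity)) hF0
    _ = _ := by ring

/-- **THE (1.12)-DERIVATIVE INPUT SHAPE (gen 17's `close112_flat_cube_deriv_level`) IN THE FORM [7] PRINTS AT `A ≠ 0`, AT A REGULAR
`u = e^{ieεA}`**: for every pair `□ ⊆ Ω` of big-block unions (`B ⊆ X`), `A` regular on `Ω`, every bond source `x` WITH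
`{y : |y − x|_∞ ≦ 2rS + 2L^kL^s(d+1) + 1} ⊂ □` («with the same restrictions on x, x′»; then `x + e_μ ∈ □` too), every `f` supported in `□` with
`‖f‖ ≦ F` at sup-torus distance `≧ D` from `x`, all reals `D_b, D_f` dominated by the sup-torus distances from `x`, resp. `supp f`, to `T ∖ □`,
every `μ`:  `‖covD ε⁻¹ u (G_k(□,u)f) ⟨x,μ⟩ − covD ε⁻¹ u (G_k(Ω,u)f) ⟨x,μ⟩‖ ≦ s_k·(c₀·e^{−δ₀·((L^k)⁻¹D)}·e^{−δ₀·((L^k)⁻¹(D_b+D_f))}·F)`,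
`δ₀ = 1/(8L^s)`. [cite: Balaban1983RegularityDecay, Theorem p.573 (1.11)–(1.12)] [cite: Balaban1982Higgs1, Prop. 2.1 (2.26) pp.610–611]
[cite: BalabanImbrieJaffe1985, p.326 «also satisfy the regularity and decay estimates of [7]»] -/
theorem input112_deriv_regular_deep (d L : ℕ) (hd : 1 ≤ d) (hL : 2 ≤ L) {a : ℝ} (ha : 0 < a) (e creg β : ℝ) (hcreg : 0 ≤ creg)
    (hβ : 0 < β) :
    ∃ s₀ : ℕ, ∀ s : ℕ, s₀ ≤ s → ∃ c₀ e₁ : ℝ, 0 < c₀ ∧ 0 < e₁ ∧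
      ∀ (P : Params), P.d = d → P.L = L → ∀ {k : ℕ}, 1 ≤ k → k ≤ P.K → k + s ≤ P.m + P.K →
      3 * (L ^ k * L ^ s) ≤ P.sitesPerDir 0 →
      ∀ (B X : Finset (Balaban1983to89.Site P 0)),
        (∀ z z' : Balaban1983to89.Site P 0,
          (∀ μ, (z μ).val / (L ^ k * L ^ s) = (z' μ).val / (L ^ k * L ^ s)) → (z ∈ B ↔ z' ∈ B)) →
        (∀ z z' : Balaban1983to89.Site P 0,
          (∀ μ, (z μ).val / (L ^ k * L ^ s) = (z' μ).val / (L ^ k * L ^ s)) → (z ∈ X ↔ z' ∈ X)) →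
        B ⊆ X →
      ∀ (A : PBond P 0 → ℝ) {ec : ℝ}, 0 < ec → ec ≤ e₁ →
      (∀ z ∈ X, ∀ μ ν : Fin P.d,
          P.spacing k * |e| / ec * |A ⟨z.shift μ, ν⟩ - A ⟨z, ν⟩| ≤ creg * ec ^ (β - 1) / (L : ℝ) ^ k) →
      ∀ (x : Balaban1983to89.Site P 0),
        (∀ y, B5Ineq137Torus.T P 0 x y
          ≤ (2 * (5 * (L ^ k * L ^ s) / 8 + L ^ k) + 2 * (L ^ k * L ^ s) * (d + 1) + 1 : ℕ) → y ∈ B) →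
      ∀ (f : Balaban1983to89.Site P 0 → ℂ) (F D Db Df : ℝ), (∀ y, ‖f y‖ ≤ F) → (∀ y, y ∉ B → f y = 0) →
        (∀ y, f y ≠ 0 → D ≤ B5Ineq137Torus.T P 0 x y) → (∀ w, w ∉ B → Db ≤ B5Ineq137Torus.T P 0 x w) →
        (∀ y, f y ≠ 0 → ∀ w, w ∉ B → Df ≤ B5Ineq137Torus.T P 0 y w) → ∀ (μ : Fin P.d),
        ‖covD P.eps⁻¹ (cfg (expGauge P e A))
              (gBox (B1RG242Torus.α P a k * (P.L : ℝ) ^ (k * P.d)) P.eps⁻¹ (expGauge P e A) k B *ᵥ f) ⟨x, μ⟩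
          - covD P.eps⁻¹ (cfg (expGauge P e A))
              (gBox (B1RG242Torus.α P a k * (P.L : ℝ) ^ (k * P.d)) P.eps⁻¹ (expGauge P e A) k X *ᵥ f) ⟨x, μ⟩‖
          ≤ P.spacing k * (c₀ * Real.exp (-(1 / (8 * (L : ℝ) ^ s) * (((P.L : ℝ) ^ k)⁻¹ * D)))
              * Real.exp (-(1 / (8 * (L : ℝ) ^ s) * (((P.L : ℝ) ^ k)⁻¹ * (Db + Df)))) * F) := by
  obtain ⟨s₀, hs₀⟩ := norm_covD_gBox_sub_gBox_mulVec_le d L hd hL ha e creg β hcreg hβ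
  refine ⟨s₀, fun s hs => ?_⟩
  obtain ⟨c₀, e₁, hc₀, he₁, hmain⟩ := hs₀ s hs
  refine ⟨c₀, e₁, hc₀, he₁, ?_⟩
  intro P hPd hPL k hk1 hkK hks hsize B X hbig hbigX hsub A ec hec hece hreg x hint f F D Db Df hF hfB hsD hsDb hsDf μ
  have hF0 : 0 ≤ F := (norm_nonneg _).trans (hF x)
  have hLr : (0 : ℝ) < L := by exact_mod_cast (show 0 < L by omega)
  have hLs : (0 : ℝ) < (L : ℝ) ^ s := pow_pos hLr s
  have hLk : (0 : ℝ) < (L : ℝ) ^ k := pow_pos hLr k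
  have hsk : 0 < P.spacing k := P.spacing_pos k
  have h := hmain P hPd hPL hk1 hkK hks hsize B X hbig hbigX hsub A hec hece hreg x
    (fun y hy => hint y (by
      rw [B3Bound323ZeroTorus.T_eq_supDist]
      exact_mod_cast hy))
    f F (max D 0) (max Db 0) (max Df 0) hF hfB (le_max_right _ _) (le_max_right _ _) (le_max_right _ _)
    (fun z hz => by
      rw [← B3Bound323ZeroTorus.T_eq_supDist]
      exact max_le (hsD z hz) (B5Ineq137Torus.T_nonneg P 0 x z))
    (fun z hz => by
      rw [← B3Bound323ZeroTorus.T_eq_supDist]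
      exact max_le (hsDb z hz) (B5Ineq137Torus.T_nonneg P 0 x z))
    (fun y z hy hz => by
      rw [← B3Bound323ZeroTorus.T_eq_supDist, B5Ineq137Torus.T_symm]
      exact max_le (hsDf y hy z hz) (B5Ineq137Torus.T_nonneg P 0 y z)) μ
  have hPLk : ((L : ℝ) ^ k)⁻¹ = ((P.L : ℝ) ^ k)⁻¹ := by rw [hPL]
  have hPk : (0 : ℝ) < (P.L : ℝ) ^ k := pow_pos P.cast_L_pos k
  rw [exp_units 8 ((L : ℝ) ^ s) ((L : ℝ) ^ k) (max D 0 + max Db 0 + max Df 0) (by norm_num) hLs.ne' hLk.ne', hPLk] at h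
  have hδ : (0 : ℝ) ≤ 1 / (8 * (L : ℝ) ^ s) := by positivity
  have hsub' : covD P.eps⁻¹ (cfg (expGauge P e A))
        (gBox (B1RG242Torus.α P a k * (P.L : ℝ) ^ (k * P.d)) P.eps⁻¹ (expGauge P e A) k B *ᵥ f) ⟨x, μ⟩
      - covD P.eps⁻¹ (cfg (expGauge P e A))
        (gBox (B1RG242Torus.α P a k * (P.L : ℝ) ^ (k * P.d)) P.eps⁻¹ (expGauge P e A) k X *ᵥ f) ⟨x, μ⟩
      = covD P.eps⁻¹ (cfg (expGauge P e A))
        (gBox (B1RG242Torus.α P a k * (P.L : ℝ) ^ (k * P.d)) P.eps⁻¹ (expGauge P e A) k B *ᵥ f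
          - gBox (B1RG242Torus.α P a k * (P.L : ℝ) ^ (k * P.d)) P.eps⁻¹ (expGauge P e A) k X *ᵥ f) ⟨x, μ⟩ := by
    simp only [covD, Pi.sub_apply]
    ring
  rw [hsub']
  calc _ ≤ c₀ * P.spacing k
        * Real.exp (-(1 / (8 * (L : ℝ) ^ s) * (((P.L : ℝ) ^ k)⁻¹ * (max D 0 + max Db 0 + max Df 0)))) * F := h
    _ ≤ c₀ * P.spacing k * (Real.exp (-(1 / (8 * (L : ℝ) ^ s) * (((P.L : ℝ) ^ k)⁻¹ * D)))
          * Real.exp (-(1 / (8 * (L : ℝ) ^ s) * (((P.L : ℝ) ^ k)⁻¹ * (Db + Df))))) * F := by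
        refine mul_le_mul_of_nonneg_right (mul_le_mul_of_nonneg_left ?_ (by positivity)) hF0
        rw [← Real.exp_add]
        refine Real.exp_le_exp.2 ?_
        have hLki : (0 : ℝ) ≤ ((P.L : ℝ) ^ k)⁻¹ := (inv_pos.2 hPk).le
        have h1 : D + (Db + Df) ≤ max D 0 + max Db 0 + max Df 0 := by
          linarith [le_max_left D 0, le_max_left Db 0, le_max_left Df 0]
        nlinarith [mul_le_mul_of_nonneg_left (mul_le_mul_of_nonneg_left h1 hLki) hδ]
    _ = _ := by ring

end InputShapes

end

end Literature.MathematicalPhysics.QuantumFieldTheory.BalabanImbrieJaffe1984to88.BIJ85NeumannPropagatorRegularDeriv
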